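import Literature.NumberTheory.LFunctions.ZeroPairSecondMoment
import Literature.NumberTheory.LFunctions.ZeroStatisticsProofs
import Literature.NumberTheory.LFunctions.SelbergFujiiMoments
import Literature.NumberTheory.LFunctions.RiemannSiegelThetaBounds
import HarnessLib

/-!
# GLSS 2026, §3 Propositions 1 and 2(b), and the assembly of (3.2): the second moment of zeros in
short intervals is
`𝒮(T, λ)` — proofs

LABEL (cell `rh-crit`, corpus C5 `ah`): **NOT RH-BEARING.** Unconditional zero-counting
bookkeeping (no hypothesis at all: a finite-sum identity plus the Riemann–von Mangoldt formula
already in the tree); THEOREMS ONLY, no definition, no named fact. First brick of the road to the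
named fact `glss2026_dsec2` (`ZeroPairSecondMoment.lean`, rh-crit/ah GAP G-ah-10), whose printed
proof is Proposition 1 + Proposition 2 of GLSS 2026, §3. bears_on: LADDER-RH §4 HELD «conditional
bridges: exceptional zero ⇒ …». WHAT THIS IS NOT: a claim about RH, AH or `glss2026_dsec2` itself;
nothing here bears on the truth of RH.

Source (held `paper:arxiv-2507.06823`, p. 7): Goldston–Lee–Schettler–Suriajaya, *On the average
of the densities of pairs of zeros …* (GLSS 2026), §3 "The Method of Gallagher and Mueller":
"The key idea lies in the estimate of the summation over pairs of zeros
`𝒮(T,λ) := Σ_{ρ,ρ' : 0<γ,γ'≤T, |(γ−γ')L| ≤ λ} (λ/L − |γ−γ'|)`, for a real number `λ > 0`, which is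
closely related to the second moment for zeros in short intervals. Proposition 1 (Gallagher and
Mueller [GaMu78]). For `λ > 0`, we have, as `T → ∞`,
`∫_0^T (N(t + λ/L) − N(t))² dt = 𝒮(T,λ) + O(L²)`." ("Both propositions below come from [GLSS1],
and the proofs are given in Section 4 of [GLSS1].") Tree vocabulary: `GLSS2026.secondMomentSum`
(= `𝒮`), `GLSS2026.L T = log T/(2π)`, `zeroIndexSet T` / `zetaOrdinate` (zeros `0 < γ ≤ T` with
multiplicity), `zetaZeroCount` (= `N`).

## What is proved (our route; glosses, not quotations)

* `GLSS2026.integral_card_window_sq` / `…_eq_secondMomentSum` — the EXACT identity behind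
  Proposition 1: for the truncated window count `W(t) := #{γ ≤ T : t < γ ≤ t + h}`,
  `∫_ℝ W(t)² dt = Σ_{γ,γ' ≤ T} (h − |γ − γ'|)⁺`, and the right side is `𝒮(T, λ)` at `h = λ/L`
  (`GLSS2026.secondMomentSum_eq_sum_max`). Proof: `W(t) = Σ_γ 1_{[γ−h, γ)}(t)`
  (`card_window_eq_sum_indicator`), expand the square, `∫ 1_{[γ−h,γ)}1_{[γ'−h,γ')} =
  vol([γ−h,γ) ∩ [γ'−h,γ')) = (h − |γ−γ'|)⁺`.
* `GLSS2026.card_window_eq_sub` (`W = N(·+h) − N` for `t + h ≤ T`), `card_window_le_sub`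
  (`W ≤ N(·+h) − N` everywhere), `card_window_eq_zero` (`supp W ⊆ (−h, T]`, all ordinates being
  positive: tree `zetaOrdinate_pos_holds`, `mem_zeroIndexSet_iff_holds`).
* `GLSS2026.abs_secondMomentSum_sub_integral_le` — Proposition 1 with an EXPLICIT edge term:
  for `T > 1`, `λ > 0`, `h = λ/L ≤ T`,
  `|𝒮(T,λ) − ∫_0^T (N(t+h) − N(t))² dt| ≤ h (N(h)² + (N(T+h) − N(T−h))²)`
  (the edges `[−h, 0]` and `[T−h, T]`).
* `glss2026_proposition1` — the asymptotic form: for each `λ > 0` there is `C = C(λ)` with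
  `|𝒮(T,λ) − ∫_0^T (N(t+λ/L) − N(t))² dt| ≤ C log T` for all large `T` (`N(h) ≤ N(1)`,
  `N(T+1) − N(T−1) ≤ 2K₁ log T` from the tree's `SelbergFujii.exists_zetaZeroCount_add_one_sub_le`);
  this is `O(L)`, which implies the printed `O(L²)`.

* `glss2026_proposition2b_of_fujii` — Proposition 2, second display
  (`∫_0^T (S(t+λ/L) − S(t))² = (T/π²) log(2+λ) + O(T√log(2+λ))`, constant ABSOLUTE) from Fujii's
  mean square (Titchmarsh (9.25.2)) taken as a hypothesis in the tree's binder shape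
  (`SelbergFujii.first_moment_of_moments`); no named fact is introduced.

* `glss2026_dsec2_of_prop2a_of_fujii` — the ASSEMBLY of (3.2): the named fact `glss2026_dsec2`
  from the two hypotheses `h2a` (Proposition 2, first display, weakened to the error
  `A₂(λ²T/L + T)`) and `h252` (Fujii's (9.25.2)), everything else being proved here; the constant
  `A₀ = |A₂| + 2(|A₂| + 2) + |A₁|` is absolute as the fact demands.

* (v2) `GLSS2026.abs_theta_window_sub_le` — `|θ(t+h) − θ(t) − (h/2) log(t/2π)| ≤ 3h/t`
  (`t ≥ 1`, `0 ≤ h ≤ 1`; from the tree's `abs_riemannSiegelThetaDeriv_sub_log_le`), and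
  `GLSS2026.abs_integral_thetaWindow_sq_sub_le` — the `θ`-DIAGONAL of `h2a`:
  `|∫_0^T ((θ(t+λ/L) − θ(t))/π)² dt − λ²T| ≤ 4(λ²T/L + T)` for all large `T` (each `λ > 0`),
  i.e. the main term `λ²T + O(λ²T/L)` of Proposition 2's first display comes from
  `(θ(t+h) − θ(t))/π = λ(log t − log 2π)/log T + O(h/t)` and `∫_1^T (log t − log 2π)² dt`.
  What remains of `h2a` is the cross term `2∫_0^T ((θ(t+h)−θ(t))/π)(S(t+h) − S(t)) dt = O_λ(log T)`
  (Abel shift + `sup |S| ≪ log t`; successor memo).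

* (v3) `GLSS2026.abs_theta_secondDiff_le` (`|Δ²_h θ(u)| ≤ 10h/u`, `u ≥ 2`),
  `GLSS2026.abs_integral_thetaWindow_mul_argWindow_le` — the CROSS TERM
  `|∫_0^T ((θ(t+h)−θ(t))/π)(S(t+h) − S(t)) dt| ≤ T` for all large `T` (each `λ > 0`; Abel shift by
  `h`, `θ` second difference, `S(T) = O(log T)` via the tree's `isBigO_zetaArgS_log_holds`; NOT
  Cauchy–Schwarz), hence **`glss2026_proposition2a`** (Proposition 2, first display, in the
  weakened form `A₂(λ²T/L + T)`, PROVED) and **`glss2026_dsec2_of_fujii (h252) : glss2026_dsec2`**: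
  (3.2) holds as soon as Fujii's (9.25.2) is supplied (binder shape of
  `SelbergFujii.first_moment_of_moments`). rh-crit/ah G-ah-10: `glss2026_dsec2` ⇐ {(9.25.2)} only;
likewise
  `glss2026_theorem2/3/4_of_fujii`, `glss2026_corollary2_of_fujii` (the whole GLSS 2026 block
  modulo (9.25.2), via `AlternativeHypothesisConsequencesProofs`).

Proposition 2, first display itself (the Riemann–von Mangoldt algebra `∫(ΔN)² = λ²T + O(λ²T/L) +
∫(ΔS)² + O(L²)`, whose cross term needs `sup|S| ≪ log t`, not Cauchy–Schwarz, to keep the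
constant absolute in `λ`) was the successor item of rh-crit/ah MEMO-t6-dsec2-road.md and is PROVED
in v3 (above);
`glss2026_dsec2_holds` is now the one-line instantiation of `glss2026_dsec2_of_fujii` once (9.25.2)
is a tree theorem.

## References

* [GoldstonLeeSchettlerSuriajaya2026] §3, (3.1), Proposition 1 (attributed there to
  P. X. Gallagher and J. H. Mueller, *Primes and zeros in short intervals*, J. reine angew. Math.
  303/304 (1978), 205–220, and to [GLSS1] §4 for the proof).
* [Titchmarsh1986] Thm. 9.4 (Riemann–von Mangoldt; tree
`SelbergFujii.exists_zetaZeroCount_add_one_sub_le`).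
-/

noncomputable section

open MeasureTheory Filter intervalIntegral
open scoped Real

namespace Literature.NumberTheory.LFunctions

namespace GLSS2026

/-! ### The overlap of two windows -/

/-- `vol([a−h, a) ∩ [b−h, b)) = (h − |a − b|)⁺`. [folklore] -/
private theorem volume_real_Ico_inter_Ico (a b h : ℝ) :
    volume.real (Set.Ico (a - h) a ∩ Set.Ico (b - h) b) = max (h - |a - b|) 0 := by
  rw [Set.Ico_inter_Ico, Real.volume_real_Ico]
  congr 1
  rcases le_total a b with hab | hab
  · rw [abs_of_nonpos (by linarith), min_eq_left hab, max_eq_right (by linarith)]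
    ring
  · rw [abs_of_nonneg (by linarith), min_eq_right hab, max_eq_left (by linarith)]
    ring

/-- `∫ 1_{[a−h,a)} 1_{[b−h,b)} = (h − |a − b|)⁺`. [folklore] -/
private theorem integral_indicator_mul_indicator (a b h : ℝ) :
    ∫ t, (Set.Ico (a - h) a).indicator (1 : ℝ → ℝ) t * (Set.Ico (b - h) b).indicator 1 t =
      max (h - |a - b|) 0 := by
  have e : (fun t ↦ (Set.Ico (a - h) a).indicator (1 : ℝ → ℝ) t *
      (Set.Ico (b - h) b).indicator 1 t) =
      (Set.Ico (a - h) a ∩ Set.Ico (b - h) b).indicator (1 : ℝ → ℝ) := by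
    rw [Set.inter_indicator_one]
    rfl
  rw [e, integral_indicator_one (measurableSet_Ico.inter measurableSet_Ico),
    volume_real_Ico_inter_Ico]

/-- `1_{[a−h,a)} 1_{[b−h,b)}` is integrable. [folklore] -/
private theorem integrable_indicator_mul_indicator (a b h : ℝ) :
    Integrable fun t ↦ (Set.Ico (a - h) a).indicator (1 : ℝ → ℝ) t *
      (Set.Ico (b - h) b).indicator 1 t := by
  have e : (fun t ↦ (Set.Ico (a - h) a).indicator (1 : ℝ → ℝ) t *
      (Set.Ico (b - h) b).indicator 1 t) =
      (Set.Ico (a - h) a ∩ Set.Ico (b - h) b).indicator (1 : ℝ → ℝ) := by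
    rw [Set.inter_indicator_one]
    rfl
  rw [e, integrable_indicator_iff (measurableSet_Ico.inter measurableSet_Ico)]
  exact integrableOn_const (measure_ne_top_of_subset Set.inter_subset_left measure_Ico_lt_top.ne)

/-! ### Gallagher–Mueller: the second moment of the window count is `𝒮` -/

/-- The window count `#{γ ∈ (t, t+h] : γ a zero ≤ T}` as a sum of indicators
`1_{[γ−h, γ)}(t)`. [cite: GoldstonLeeSchettlerSuriajaya2026, §3 Proposition 1] -/
theorem card_window_eq_sum_indicator (T h t : ℝ) :
    (((zeroIndexSet T).filter fun i ↦ t < zetaOrdinate i ∧ zetaOrdinate i ≤ t + h).card : ℝ) =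
      ∑ i ∈ zeroIndexSet T, (Set.Ico (zetaOrdinate i - h) (zetaOrdinate i)).indicator 1 t := by
  classical
  rw [Finset.card_filter, Nat.cast_sum]
  refine Finset.sum_congr rfl fun i _ ↦ ?_
  simp only [Set.indicator_apply, Set.mem_Ico, Pi.one_apply]
  by_cases h1 : t < zetaOrdinate i ∧ zetaOrdinate i ≤ t + h
  · rw [if_pos h1, if_pos ⟨by linarith [h1.2], h1.1⟩]; simp
  · rw [if_neg h1, if_neg (fun h2 ↦ h1 ⟨h2.2, by linarith [h2.1]⟩)]; simp

/-- **Gallagher–Mueller's identity (GLSS 2026, Proposition 1, exact core).** For `h ≥ 0`... in fact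
for every
real `h`: `∫_ℝ (#{γ ≤ T : t < γ ≤ t + h})² dt = Σ_{γ,γ' ≤ T} (h − |γ − γ'|)⁺`
(expand the square and integrate `1_{[γ−h,γ)} 1_{[γ'−h,γ')}`).
[cite: GoldstonLeeSchettlerSuriajaya2026, §3 Proposition 1] -/
theorem integral_card_window_sq (T h : ℝ) :
    ∫ t, (((zeroIndexSet T).filter fun i ↦ t < zetaOrdinate i ∧ zetaOrdinate i ≤ t + h).card : ℝ) ^ 2 =
      ∑ p ∈ zeroIndexSet T ×ˢ zeroIndexSet T,
        max (h - |zetaOrdinate p.1 - zetaOrdinate p.2|) 0 := by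
  have e : (fun t : ℝ ↦
      (((zeroIndexSet T).filter fun i ↦ t < zetaOrdinate i ∧ zetaOrdinate i ≤ t + h).card : ℝ) ^ 2) =
      fun t ↦ ∑ p ∈ zeroIndexSet T ×ˢ zeroIndexSet T,
        (Set.Ico (zetaOrdinate p.1 - h) (zetaOrdinate p.1)).indicator (1 : ℝ → ℝ) t *
          (Set.Ico (zetaOrdinate p.2 - h) (zetaOrdinate p.2)).indicator 1 t := by
    funext t
    rw [card_window_eq_sum_indicator, sq, Finset.sum_mul_sum, Finset.sum_product]
  rw [e, integral_finsetSum _ fun p _ ↦ integrable_indicator_mul_indicator _ _ _]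
  exact Finset.sum_congr rfl fun p _ ↦ integral_indicator_mul_indicator _ _ _

/-- `𝒮(T, λ)` as a sum of positive parts over ALL pairs (for `T > 1`, so that `L > 0`):
`𝒮(T, λ) = Σ_{γ,γ' ≤ T} (λ/L − |γ − γ'|)⁺`. [cite: GoldstonLeeSchettlerSuriajaya2026, §3 eq. (3.1)]
-/
theorem secondMomentSum_eq_sum_max {T : ℝ} (hT : 1 < T) (lam : ℝ) :
    secondMomentSum T lam =
      ∑ p ∈ zeroIndexSet T ×ˢ zeroIndexSet T,
        max (lam / L T - |zetaOrdinate p.1 - zetaOrdinate p.2|) 0 := by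
  classical
  have hL : 0 < L T := L_pos hT
  rw [secondMomentSum_def, Finset.sum_filter]
  refine Finset.sum_congr rfl fun p _ ↦ ?_
  by_cases h : |(zetaOrdinate p.1 - zetaOrdinate p.2) * L T| ≤ lam
  · rw [if_pos h]
    rw [abs_mul, abs_of_pos hL, ← le_div_iff₀ hL] at h
    rw [max_eq_left (by linarith)]
  · rw [if_neg h]
    rw [abs_mul, abs_of_pos hL, ← le_div_iff₀ hL, not_le] at h
    rw [max_eq_right (by linarith)]

/-- **GLSS 2026, Proposition 1 (Gallagher–Mueller), exact form for the truncated count**: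
`∫_ℝ (#{γ ≤ T : t < γ ≤ t + λ/L})² dt = 𝒮(T, λ)` (`T > 1`).
[cite: GoldstonLeeSchettlerSuriajaya2026, §3 Proposition 1] -/
theorem integral_card_window_sq_eq_secondMomentSum {T : ℝ} (hT : 1 < T) (lam : ℝ) :
    ∫ t, (((zeroIndexSet T).filter fun i ↦
        t < zetaOrdinate i ∧ zetaOrdinate i ≤ t + lam / L T).card : ℝ) ^ 2 =
      secondMomentSum T lam := by
  rw [integral_card_window_sq, secondMomentSum_eq_sum_max hT]

/-! ### The window count is `N(t + h) − N(t)` away from the edge -/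

/-- For `t + h ≤ T` the truncated window count is `N(t+h) − N(t)`.
[cite: GoldstonLeeSchettlerSuriajaya2026, §3 Proposition 1] -/
theorem card_window_eq_sub {T h t : ℝ} (hh : 0 ≤ h) (ht : t + h ≤ T) :
    ((zeroIndexSet T).filter fun i ↦ t < zetaOrdinate i ∧ zetaOrdinate i ≤ t + h).card =
      zetaZeroCount (t + h) - zetaZeroCount t := by
  classical
  have hmem : ∀ {S : ℝ} {n : ℕ}, n ∈ zeroIndexSet S ↔ zetaOrdinate n ≤ S :=
    mem_zeroIndexSet_iff_holds
  have hsub : zeroIndexSet t ⊆ zeroIndexSet (t + h) := by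
    intro i hi
    rw [hmem] at hi ⊢
    linarith
  have e : ((zeroIndexSet T).filter fun i ↦ t < zetaOrdinate i ∧ zetaOrdinate i ≤ t + h) =
      zeroIndexSet (t + h) \ zeroIndexSet t := by
    ext i
    simp only [Finset.mem_filter, Finset.mem_sdiff, hmem, not_le]
    constructor
    · rintro ⟨-, h1, h2⟩; exact ⟨h2, h1⟩
    · rintro ⟨h1, h2⟩; exact ⟨by linarith, h2, h1⟩
  rw [e, Finset.card_sdiff_of_subset hsub, card_zeroIndexSet, card_zeroIndexSet]

/-- `W ≤ N(t+h) − N(t)` everywhere (`h ≥ 0`). [cite: GoldstonLeeSchettlerSuriajaya2026, §3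
Proposition 1] -/
theorem card_window_le_sub {T h : ℝ} (hh : 0 ≤ h) (t : ℝ) :
    (((zeroIndexSet T).filter fun i ↦ t < zetaOrdinate i ∧ zetaOrdinate i ≤ t + h).card : ℝ) ≤
      (zetaZeroCount (t + h) : ℝ) - zetaZeroCount t := by
  classical
  have hmem : ∀ {S : ℝ} {n : ℕ}, n ∈ zeroIndexSet S ↔ zetaOrdinate n ≤ S :=
    mem_zeroIndexSet_iff_holds
  have hsub : zeroIndexSet t ⊆ zeroIndexSet (t + h) := by
    intro i hi
    rw [hmem] at hi ⊢
    linarith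
  have hle : ((zeroIndexSet T).filter fun i ↦ t < zetaOrdinate i ∧ zetaOrdinate i ≤ t + h).card ≤
      (zeroIndexSet (t + h) \ zeroIndexSet t).card := by
    refine Finset.card_le_card fun i hi ↦ ?_
    rw [Finset.mem_filter] at hi
    rw [Finset.mem_sdiff, hmem, hmem, not_le]
    exact ⟨hi.2.2, hi.2.1⟩
  rw [Finset.card_sdiff_of_subset hsub, card_zeroIndexSet, card_zeroIndexSet] at hle
  have hmono : zetaZeroCount t ≤ zetaZeroCount (t + h) := zetaZeroCount_mono (by linarith)
  have := (Nat.cast_le (α := ℝ)).mpr hle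
  rw [Nat.cast_sub hmono] at this
  exact this

/-- The truncated window count vanishes off `(−h, T]` (all ordinates are positive).
[cite: GoldstonLeeSchettlerSuriajaya2026, §3 Proposition 1] -/
theorem card_window_eq_zero {T h t : ℝ} (ht : t ∉ Set.Ioc (-h) T) :
    ((zeroIndexSet T).filter fun i ↦ t < zetaOrdinate i ∧ zetaOrdinate i ≤ t + h).card = 0 := by
  classical
  have hmem : ∀ {S : ℝ} {n : ℕ}, n ∈ zeroIndexSet S ↔ zetaOrdinate n ≤ S :=
    mem_zeroIndexSet_iff_holds
  rw [Finset.card_eq_zero, Finset.filter_eq_empty_iff]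
  intro i hi ⟨h1, h2⟩
  rw [hmem] at hi
  rw [Set.mem_Ioc, not_and_or, not_lt, not_le] at ht
  rcases ht with ht | ht
  · have := zetaOrdinate_pos_holds i
    linarith
  · linarith

/-- A measurable real function bounded on `[a, b]` is interval integrable there. [folklore] -/
private theorem intervalIntegrable_of_abs_le' {f : ℝ → ℝ} {a b C : ℝ} (hab : a ≤ b)
    (hf : Measurable f) (hC : ∀ t ∈ Set.Icc a b, |f t| ≤ C) : IntervalIntegrable f volume a b := by
  rw [intervalIntegrable_iff_integrableOn_Icc_of_le hab]
  refine Measure.integrableOn_of_bounded (M := C) measure_Icc_lt_top.ne hf.aestronglyMeasurable ?_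
  exact (ae_restrict_iff' measurableSet_Icc).2 (Filter.Eventually.of_forall fun t ht ↦ by
    rw [Real.norm_eq_abs]; exact hC t ht)

/-- `t ↦ (N(t + h) − N(t))²` is interval integrable (monotone pieces, bounded on compacts).
[folklore] -/
private theorem intervalIntegrable_sub_sq (h a b : ℝ) (hab : a ≤ b) :
    IntervalIntegrable (fun t ↦ ((zetaZeroCount (t + h) : ℝ) - zetaZeroCount t) ^ 2)
      volume a b := by
  have hm1 : Measurable fun t : ℝ ↦ (zetaZeroCount (t + h) : ℝ) := by
    refine Monotone.measurable fun x y hxy ↦ ?_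
    exact_mod_cast zetaZeroCount_mono (by linarith : x + h ≤ y + h)
  have hm2 : Measurable fun t : ℝ ↦ (zetaZeroCount t : ℝ) :=
    Monotone.measurable fun x y hxy ↦ by exact_mod_cast zetaZeroCount_mono hxy
  refine intervalIntegrable_of_abs_le' (C := ((zetaZeroCount (b + h) : ℝ) + zetaZeroCount b) ^ 2)
    hab ((hm1.sub hm2).pow_const 2) fun t ht ↦ ?_
  rw [abs_pow, sq_abs]
  have h1 : (zetaZeroCount (t + h) : ℝ) ≤ zetaZeroCount (b + h) := by
    exact_mod_cast zetaZeroCount_mono (by linarith [ht.2] : t + h ≤ b + h)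
  have h2 : (zetaZeroCount t : ℝ) ≤ zetaZeroCount b := by exact_mod_cast zetaZeroCount_mono ht.2
  have h3 : (0 : ℝ) ≤ zetaZeroCount (t + h) := Nat.cast_nonneg _
  have h4 : (0 : ℝ) ≤ zetaZeroCount t := Nat.cast_nonneg _
  have h5 : |(zetaZeroCount (t + h) : ℝ) - zetaZeroCount t| ≤
      (zetaZeroCount (b + h) : ℝ) + zetaZeroCount b := by
    rw [abs_le]; constructor <;> linarith
  have h6 : 0 ≤ (zetaZeroCount (b + h) : ℝ) + zetaZeroCount b := by positivity
  calc ((zetaZeroCount (t + h) : ℝ) - zetaZeroCount t) ^ 2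
      = |(zetaZeroCount (t + h) : ℝ) - zetaZeroCount t| ^ 2 := (sq_abs _).symm
    _ ≤ ((zetaZeroCount (b + h) : ℝ) + zetaZeroCount b) ^ 2 :=
        pow_le_pow_left₀ (abs_nonneg _) h5 2

/-- **GLSS 2026, Proposition 1 (Gallagher and Mueller [GaMu78]) with an explicit edge term.**
"For `λ > 0`, we have, as `T → ∞`, `∫_0^T (N(t + λ/L) − N(t))² dt = 𝒮(T, λ) + O(L²)`." Here, for
`T > 1`, `λ > 0` and `h := λ/L ≤ T`:
`|𝒮(T, λ) − ∫_0^T (N(t+h) − N(t))² dt| ≤ h·(N(h)² + (N(T+h) − N(T−h))²)` — the exact identity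
`𝒮 = ∫_ℝ W²` for the truncated count `W(t) = #{γ ≤ T : t < γ ≤ t + h}`
(`integral_card_window_sq_eq_secondMomentSum`), `W = N(·+h) − N` on `t ≤ T − h`, `0 ≤ W ≤
N(·+h) − N` everywhere, and `supp W ⊆ (−h, T]`; the two edges `[−h, 0]`, `[T−h, T]` have length
`h` and carry at most `N(h)²`, `(N(T+h) − N(T−h))²`. (For fixed `λ` the right side is `O(L)`:
`N(h) = 0` once `h < γ₁`, and `N(T+h) − N(T−h) ≪ log T`.) Our explicit form of the printed
`O(L²)`; a gloss, not a quotation. [cite: GoldstonLeeSchettlerSuriajaya2026, §3 Proposition 1] -/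
theorem abs_secondMomentSum_sub_integral_le {T lam : ℝ} (hT : 1 < T) (hlam : 0 < lam)
    (hhT : lam / L T ≤ T) :
    |secondMomentSum T lam -
        ∫ t in (0 : ℝ)..T, ((zetaZeroCount (t + lam / L T) : ℝ) - zetaZeroCount t) ^ 2| ≤
      lam / L T * ((zetaZeroCount (lam / L T) : ℝ) ^ 2 +
        ((zetaZeroCount (T + lam / L T) : ℝ) - zetaZeroCount (T - lam / L T)) ^ 2) := by
  have hh : 0 < lam / L T := div_pos hlam (L_pos hT)
  -- notation
  set h : ℝ := lam / L T with hh_def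
  set W : ℝ → ℝ := fun t ↦
    (((zeroIndexSet T).filter fun i ↦ t < zetaOrdinate i ∧ zetaOrdinate i ≤ t + h).card : ℝ)
    with hW
  set D : ℝ → ℝ := fun t ↦ (zetaZeroCount (t + h) : ℝ) - zetaZeroCount t with hD
  set A : ℝ := (zetaZeroCount h : ℝ) with hA
  set B : ℝ := (zetaZeroCount (T + h) : ℝ) - zetaZeroCount (T - h) with hB
  -- 𝒮 = ∫_ℝ W²
  have hS : secondMomentSum T lam = ∫ t, W t ^ 2 :=
    (integral_card_window_sq_eq_secondMomentSum hT lam).symm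
  -- W² is integrable and vanishes off (−h, T]
  have hW2 : (fun t ↦ W t ^ 2) = fun t ↦ ∑ p ∈ zeroIndexSet T ×ˢ zeroIndexSet T,
      (Set.Ico (zetaOrdinate p.1 - h) (zetaOrdinate p.1)).indicator (1 : ℝ → ℝ) t *
        (Set.Ico (zetaOrdinate p.2 - h) (zetaOrdinate p.2)).indicator 1 t := by
    funext t
    simp only [hW]
    rw [card_window_eq_sum_indicator, sq, Finset.sum_mul_sum, Finset.sum_product]
  have hWi : Integrable fun t ↦ W t ^ 2 := by
    rw [hW2]
    exact integrable_finsetSum _ fun p _ ↦ integrable_indicator_mul_indicator _ _ _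
  have hsupp : ∀ t, t ∉ Set.Ioc (-h) T → W t ^ 2 = 0 := by
    intro t ht
    simp only [hW]
    rw [card_window_eq_zero ht]
    simp
  -- pointwise facts
  have hWD : ∀ t, W t ≤ D t := fun t ↦ card_window_le_sub hh.le t
  have hW0 : ∀ t, 0 ≤ W t := fun t ↦ Nat.cast_nonneg _
  have hWeq : ∀ t, t + h ≤ T → W t = D t := by
    intro t ht
    simp only [hW, hD]
    rw [card_window_eq_sub hh.le ht,
      Nat.cast_sub (zetaZeroCount_mono (by linarith : t ≤ t + h))]
  have hmono : ∀ {x y : ℝ}, x ≤ y → (zetaZeroCount x : ℝ) ≤ zetaZeroCount y := fun hxy ↦ by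
    exact_mod_cast zetaZeroCount_mono hxy
  -- interval integrability
  have iW : ∀ a b : ℝ, IntervalIntegrable (fun t ↦ W t ^ 2) volume a b :=
    fun a b ↦ hWi.intervalIntegrable
  have iD : ∀ a b : ℝ, a ≤ b → IntervalIntegrable (fun t ↦ D t ^ 2) volume a b :=
    fun a b hab ↦ intervalIntegrable_sub_sq h a b hab
  -- ∫_ℝ W² = ∫_{-h}^{T} W² = ∫_{-h}^0 + ∫_0^{T-h} + ∫_{T-h}^T
  have e1 : ∫ t, W t ^ 2 = ∫ t in (-h)..T, W t ^ 2 := by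
    rw [intervalIntegral.integral_of_le (by linarith),
      setIntegral_eq_integral_of_forall_compl_eq_zero hsupp]
  have e2 : ∫ t in (-h)..T, W t ^ 2 = (∫ t in (-h)..0, W t ^ 2) +
      ((∫ t in (0 : ℝ)..(T - h), W t ^ 2) + ∫ t in (T - h)..T, W t ^ 2) := by
    rw [intervalIntegral.integral_add_adjacent_intervals (iW _ _) (iW _ _),
      intervalIntegral.integral_add_adjacent_intervals (iW _ _) (iW _ _)]
  have e3 : ∫ t in (0 : ℝ)..T, D t ^ 2 =
      (∫ t in (0 : ℝ)..(T - h), D t ^ 2) + ∫ t in (T - h)..T, D t ^ 2 := by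
    rw [intervalIntegral.integral_add_adjacent_intervals (iD _ _ (by linarith))
      (iD _ _ (by linarith))]
  have e4 : ∫ t in (0 : ℝ)..(T - h), W t ^ 2 = ∫ t in (0 : ℝ)..(T - h), D t ^ 2 := by
    refine intervalIntegral.integral_congr fun t ht ↦ ?_
    rw [Set.uIcc_of_le (by linarith)] at ht
    exact congrArg (· ^ 2) (hWeq t (by linarith [ht.2]))
  -- edge bounds
  have b1 : 0 ≤ ∫ t in (-h)..0, W t ^ 2 :=
    intervalIntegral.integral_nonneg (by linarith) fun t _ ↦ by positivity
  have b2 : ∫ t in (-h)..0, W t ^ 2 ≤ h * A ^ 2 := by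
    have hle := intervalIntegral.integral_mono_on (by linarith : -h ≤ 0) (iW _ _)
      (continuous_const.intervalIntegrable _ _) (g := fun _ ↦ A ^ 2) fun t ht ↦ by
        have hDt : D t ≤ A := by
          simp only [hD, hA]
          have := hmono (by linarith [ht.2] : t + h ≤ h)
          have : (0 : ℝ) ≤ zetaZeroCount t := Nat.cast_nonneg _
          linarith
        exact pow_le_pow_left₀ (hW0 t) ((hWD t).trans hDt) 2
    refine hle.trans ?_
    rw [intervalIntegral.integral_const, smul_eq_mul]
    linarith
  have b3 : 0 ≤ ∫ t in (T - h)..T, W t ^ 2 :=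
    intervalIntegral.integral_nonneg (by linarith) fun t _ ↦ by positivity
  have b4 : ∫ t in (T - h)..T, W t ^ 2 ≤ ∫ t in (T - h)..T, D t ^ 2 :=
    intervalIntegral.integral_mono_on (by linarith) (iW _ _) (iD _ _ (by linarith)) fun t _ ↦
      pow_le_pow_left₀ (hW0 t) (hWD t) 2
  have b5 : ∫ t in (T - h)..T, D t ^ 2 ≤ h * B ^ 2 := by
    have hle := intervalIntegral.integral_mono_on (by linarith : T - h ≤ T) (iD _ _ (by linarith))
      (continuous_const.intervalIntegrable _ _) (g := fun _ ↦ B ^ 2) fun t ht ↦ by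
        have hD0 : 0 ≤ D t := by
          simp only [hD]
          linarith [hmono (by linarith : t ≤ t + h)]
        have hDt : D t ≤ B := by
          simp only [hD, hB]
          linarith [hmono (by linarith [ht.2] : t + h ≤ T + h), hmono (ht.1 : T - h ≤ t)]
        exact pow_le_pow_left₀ hD0 hDt 2
    refine hle.trans ?_
    rw [intervalIntegral.integral_const, smul_eq_mul]
    linarith
  -- assemble
  have hA2 : 0 ≤ h * A ^ 2 := by positivity
  have hB2 : 0 ≤ h * B ^ 2 := by positivity
  rw [hS, e1, e2, e3, e4, abs_le]
  constructor <;> nlinarith [b1, b2, b3, b4, b5]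

/-! ### The `θ`-window `θ(t + h) − θ(t)` -/

/-- `θ(t+h) − θ(t) = ∫_t^{t+h} θ'`. [folklore] -/
private theorem theta_sub_eq_integral (t h : ℝ) :
    riemannSiegelTheta (t + h) - riemannSiegelTheta t =
      ∫ u in t..t + h, riemannSiegelThetaDeriv u := by
  have hint : ∀ a b : ℝ, IntervalIntegrable riemannSiegelThetaDeriv volume a b := fun a b ↦
    continuous_riemannSiegelThetaDeriv_holds.intervalIntegrable a b
  simp only [riemannSiegelTheta]
  rw [intervalIntegral.integral_interval_sub_left (hint 0 (t + h)) (hint 0 t)]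

/-- **The `θ`-window against `½ log(t/2π)`**: for `t ≥ 1`, `0 ≤ h ≤ 1`,
`|θ(t+h) − θ(t) − (h/2) log(t/2π)| ≤ 3h/t` (from `|θ'(u) − ½ log(u/2π)| ≤ 2/u`, tree
`abs_riemannSiegelThetaDeriv_sub_log_le`, and `log(u/t) ≤ (u − t)/t`). A sharper sibling of
`SelbergFujii.abs_theta_sub_sub_le` (error `3h`, dyadic blocks). [cite: Titchmarsh1986, §4.17
(θ'(t) = ½ log(t/2π) + O(1/t))] -/
theorem abs_theta_window_sub_le {t h : ℝ} (ht : 1 ≤ t) (hh : 0 ≤ h) (hh1 : h ≤ 1) :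
    |riemannSiegelTheta (t + h) - riemannSiegelTheta t - h / 2 * Real.log (t / (2 * π))| ≤
      3 * h / t := by
  have hπ : 0 < π := Real.pi_pos
  have ht0 : 0 < t := by linarith
  have hint : ∀ a b : ℝ, IntervalIntegrable riemannSiegelThetaDeriv volume a b := fun a b ↦
    continuous_riemannSiegelThetaDeriv_holds.intervalIntegrable a b
  have e : riemannSiegelTheta (t + h) - riemannSiegelTheta t - h / 2 * Real.log (t / (2 * π)) =
      ∫ u in t..t + h, (riemannSiegelThetaDeriv u - Real.log (t / (2 * π)) / 2) := by
    rw [theta_sub_eq_integral, intervalIntegral.integral_sub (hint _ _) intervalIntegrable_const,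
      intervalIntegral.integral_const, smul_eq_mul]
    ring
  rw [e]
  have hb := intervalIntegral.norm_integral_le_of_norm_le_const (a := t) (b := t + h)
    (C := 3 / t) (f := fun u ↦ riemannSiegelThetaDeriv u - Real.log (t / (2 * π)) / 2) ?_
  · rw [Real.norm_eq_abs] at hb
    refine hb.trans (le_of_eq ?_)
    rw [show t + h - t = h by ring, abs_of_nonneg hh]
    field_simp
  · intro u hu
    rw [Set.uIoc_of_le (by linarith)] at hu
    have hu1 : 1 ≤ u := by linarith [hu.1]
    have hu0 : 0 < u := by linarith
    have h1 := abs_riemannSiegelThetaDeriv_sub_log_le hu1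
    have h2 : 0 ≤ Real.log (u / (2 * π)) - Real.log (t / (2 * π)) := by
      rw [sub_nonneg]; exact Real.log_le_log (by positivity) (by gcongr; linarith [hu.1])
    have h3 : Real.log (u / (2 * π)) - Real.log (t / (2 * π)) ≤ h / t := by
      rw [← Real.log_div (by positivity) (by positivity), show u / (2 * π) / (t / (2 * π)) = u / t by
        field_simp]
      have := Real.log_le_sub_one_of_pos (show 0 < u / t by positivity)
      have h4 : u / t - 1 ≤ h / t := by
        rw [div_sub_one (ne_of_gt ht0), div_le_div_iff_of_pos_right ht0]; linarith [hu.2]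
      linarith
    have h5 : 2 / u ≤ 2 / t := div_le_div_of_nonneg_left (by norm_num) ht0 hu.1.le
    have h6 : h / t ≤ 1 / t := div_le_div_of_nonneg_right hh1 ht0.le
    rw [Real.norm_eq_abs]
    have e2 : riemannSiegelThetaDeriv u - Real.log (t / (2 * π)) / 2 =
        (riemannSiegelThetaDeriv u - Real.log (u / (2 * π)) / 2) +
          (Real.log (u / (2 * π)) - Real.log (t / (2 * π))) / 2 := by ring
    rw [e2]
    have hB : |(Real.log (u / (2 * π)) - Real.log (t / (2 * π))) / 2| ≤ h / t := by
      rw [abs_of_nonneg (by linarith)]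
      have : 0 ≤ h / t := by positivity
      linarith
    calc |(riemannSiegelThetaDeriv u - Real.log (u / (2 * π)) / 2) +
          (Real.log (u / (2 * π)) - Real.log (t / (2 * π))) / 2|
        ≤ |riemannSiegelThetaDeriv u - Real.log (u / (2 * π)) / 2| +
          |(Real.log (u / (2 * π)) - Real.log (t / (2 * π))) / 2| := abs_add_le _ _
      _ ≤ 2 / u + h / t := add_le_add h1 hB
      _ ≤ 3 / t := by
          have : (3 : ℝ) / t = 2 / t + 1 / t := by ring
          rw [this]
          linarith

/-- The antiderivative of `(log t − c)²`: `t(log t − c)² − 2t(log t − c) + 2t` (`t > 0`).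
[folklore] -/
private theorem hasDerivAt_logSq_prim (c : ℝ) {t : ℝ} (ht : 0 < t) :
    HasDerivAt (fun t : ℝ ↦ t * (Real.log t - c) ^ 2 - 2 * t * (Real.log t - c) + 2 * t)
      ((Real.log t - c) ^ 2) t := by
  have hl : HasDerivAt (fun t : ℝ ↦ Real.log t - c) (1 / t) t := by
    simpa using (Real.hasDerivAt_log ht.ne').sub_const c
  have h := (((hasDerivAt_id' t).mul (hl.pow 2)).sub
    (((hasDerivAt_id' t).const_mul 2).mul hl)).add ((hasDerivAt_id' t).const_mul 2)
  have h' : HasDerivAt (fun t : ℝ ↦ t * (Real.log t - c) ^ 2 - 2 * t * (Real.log t - c) + 2 * t)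
      _ t := h
  refine h'.congr_deriv ?_
  simp only [Pi.pow_apply]
  push_cast
  field_simp
  ring

/-- `∫_1^T (log t − c)² dt = T(log T − c)² − 2T(log T − c) + 2T − (c² + 2c + 2)` (`T ≥ 1`).
[folklore] -/
private theorem integral_logSq (c : ℝ) {T : ℝ} (hT : 1 ≤ T) :
    ∫ t in (1 : ℝ)..T, (Real.log t - c) ^ 2 =
      (T * (Real.log T - c) ^ 2 - 2 * T * (Real.log T - c) + 2 * T) - (c ^ 2 + 2 * c + 2) := by
  rw [intervalIntegral.integral_eq_sub_of_hasDerivAt (fun t ht ↦ hasDerivAt_logSq_prim c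
    (by rw [Set.uIcc_of_le hT] at ht; linarith [ht.1]))]
  · simp only [Real.log_one, zero_sub, mul_one, one_mul]
    ring
  · apply ContinuousOn.intervalIntegrable
    rw [Set.uIcc_of_le hT]
    exact ((Real.continuousOn_log.mono (by intro x hx; simp; linarith [hx.1])).sub
      continuousOn_const).pow 2


/-- Main-term algebra: `|(λ/u)²(T(u−c)² − 2T(u−c) + 2T − (c²+2c+2)) − λ²T| ≤ 16λ²T/u + 10λ²`
for `u ≥ 1`, `T ≥ 0`, `0 ≤ c ≤ 2`. [folklore] -/
private theorem mainTerm_algebra {lam T u c : ℝ} (hu1 : 1 ≤ u) (hT : 0 ≤ T) (hc0 : 0 ≤ c)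
    (hc2 : c ≤ 2) :
    |(lam / u) ^ 2 * ((T * (u - c) ^ 2 - 2 * T * (u - c) + 2 * T) - (c ^ 2 + 2 * c + 2)) -
        lam ^ 2 * T| ≤ 16 * (lam ^ 2 * T / u) + 10 * lam ^ 2 := by
  have hu0 : 0 < u := by linarith
  have eE : (lam / u) ^ 2 * ((T * (u - c) ^ 2 - 2 * T * (u - c) + 2 * T) - (c ^ 2 + 2 * c + 2)) -
      lam ^ 2 * T =
      (lam ^ 2 * T * (-(2 * c + 2) * u + (c ^ 2 + 2 * c + 2)) - lam ^ 2 * (c ^ 2 + 2 * c + 2)) /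
        u ^ 2 := by
    field_simp
    ring
  rw [eE, abs_div, abs_of_pos (by positivity : 0 < u ^ 2),
    div_le_iff₀ (by positivity : 0 < u ^ 2)]
  have hK : c ^ 2 + 2 * c + 2 ≤ 10 := by nlinarith
  have hK0 : 0 ≤ c ^ 2 + 2 * c + 2 := by positivity
  have hl2 : 0 ≤ lam ^ 2 := sq_nonneg _
  have hl2T : 0 ≤ lam ^ 2 * T := by positivity
  have hA : |lam ^ 2 * T * (-(2 * c + 2) * u + (c ^ 2 + 2 * c + 2))| ≤
      lam ^ 2 * T * (6 * u + 10) := by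
    rw [abs_mul, abs_of_nonneg hl2T]
    refine mul_le_mul_of_nonneg_left ?_ hl2T
    have h1 : (2 * c + 2) * u ≤ 6 * u := by nlinarith
    rw [abs_le]; constructor <;> nlinarith
  have hB : |lam ^ 2 * (c ^ 2 + 2 * c + 2)| ≤ 10 * lam ^ 2 := by
    rw [abs_of_nonneg (by positivity)]; nlinarith
  have hC : lam ^ 2 * T * (6 * u + 10) ≤ 16 * (lam ^ 2 * T) * u := by nlinarith
  have hD : 10 * lam ^ 2 ≤ 10 * lam ^ 2 * u ^ 2 := by
    have hu2 : 1 ≤ u ^ 2 := by nlinarith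
    have := mul_le_mul_of_nonneg_left hu2 (by positivity : 0 ≤ 10 * lam ^ 2)
    linarith
  calc |lam ^ 2 * T * (-(2 * c + 2) * u + (c ^ 2 + 2 * c + 2)) - lam ^ 2 * (c ^ 2 + 2 * c + 2)|
      ≤ |lam ^ 2 * T * (-(2 * c + 2) * u + (c ^ 2 + 2 * c + 2))| +
          |lam ^ 2 * (c ^ 2 + 2 * c + 2)| := abs_sub _ _
    _ ≤ 16 * (lam ^ 2 * T) * u + 10 * lam ^ 2 * u ^ 2 := by linarith
    _ = (16 * (lam ^ 2 * T / u) + 10 * lam ^ 2) * u ^ 2 := by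
        field_simp

/-- Pointwise, on `1 ≤ t ≤ T` (`2 ≤ log T`, `h = 2πλ/log T ≤ 1`):
`|(θ(t+h) − θ(t))²/π² − (λ(log t − log 2π)/log T)²| ≤ (4λ + 1) h / t`. [cite:
GoldstonLeeSchettlerSuriajaya2026, §3 Proposition 2] -/
private theorem abs_thetaWindow_sq_sub_le {T lam t : ℝ} (hlam : 0 < lam) (hlogT : 2 ≤ Real.log T)
    (hh1 : 2 * π * lam / Real.log T ≤ 1) (ht : 1 ≤ t) (htT : t ≤ T) :
    |((riemannSiegelTheta (t + 2 * π * lam / Real.log T) - riemannSiegelTheta t) / π) ^ 2 -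
        (lam / Real.log T * (Real.log t - Real.log (2 * π))) ^ 2| ≤
      (4 * lam + 1) * (2 * π * lam / Real.log T) / t := by
  have hπ : 0 < π := Real.pi_pos
  have hπ3 : 3 < π := Real.pi_gt_three
  have ht0 : 0 < t := by linarith
  have hlog0 : 0 < Real.log T := by linarith
  set h : ℝ := 2 * π * lam / Real.log T with hh_def
  have hh0 : 0 ≤ h := by positivity
  have hc2 : Real.log (2 * π) < 2 := SelbergFujii.log_two_pi_lt_two
  have hc0 : 0 ≤ Real.log (2 * π) := Real.log_nonneg (by linarith)
  -- d := Δθ − (h/2) log(t/2π), |d| ≤ 3h/t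
  have hd := abs_theta_window_sub_le ht hh0 hh1
  set d : ℝ := riemannSiegelTheta (t + h) - riemannSiegelTheta t - h / 2 * Real.log (t / (2 * π))
    with hd_def
  -- m := (λ/log T)(log t − c) = (h/2π) log(t/2π)
  have hlogdiv : Real.log (t / (2 * π)) = Real.log t - Real.log (2 * π) :=
    Real.log_div (ne_of_gt ht0) (by positivity)
  set m : ℝ := lam / Real.log T * (Real.log t - Real.log (2 * π)) with hm_def
  have hm : h / 2 * Real.log (t / (2 * π)) = π * m := by
    rw [hlogdiv, hm_def, hh_def]; field_simp
  have hθ : (riemannSiegelTheta (t + h) - riemannSiegelTheta t) / π = m + d / π := by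
    rw [hd_def, hm]; field_simp; ring
  rw [hθ]
  -- |m| ≤ 2λ
  have hlt : Real.log t ≤ Real.log T := Real.log_le_log ht0 htT
  have hlt0 : 0 ≤ Real.log t := Real.log_nonneg ht
  have hmabs : |m| ≤ 2 * lam := by
    rw [hm_def, abs_mul, abs_of_pos (by positivity : 0 < lam / Real.log T)]
    have h1 : |Real.log t - Real.log (2 * π)| ≤ 2 * Real.log T := by
      rw [abs_le]; constructor <;> linarith
    calc lam / Real.log T * |Real.log t - Real.log (2 * π)|
        ≤ lam / Real.log T * (2 * Real.log T) := mul_le_mul_of_nonneg_left h1 (by positivity)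
      _ = 2 * lam := by field_simp
  -- |d/π| ≤ h/t ≤ 1
  have hdπ : |d / π| ≤ h / t := by
    rw [abs_div, abs_of_pos hπ, div_le_iff₀ hπ]
    calc |d| ≤ 3 * h / t := hd
      _ ≤ h / t * π := by
          rw [div_mul_eq_mul_div, div_le_div_iff_of_pos_right ht0]; nlinarith
  have hht : h / t ≤ 1 := by
    rw [div_le_one ht0]; linarith
  have e : (m + d / π) ^ 2 - m ^ 2 = d / π * (2 * m + d / π) := by ring
  rw [e, abs_mul]
  have h2 : |2 * m + d / π| ≤ 4 * lam + 1 := by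
    refine (abs_add_le _ _).trans ?_
    rw [abs_mul, abs_two]
    linarith [hdπ.trans hht]
  calc |d / π| * |2 * m + d / π| ≤ h / t * (4 * lam + 1) :=
        mul_le_mul hdπ h2 (abs_nonneg _) (by positivity)
    _ = (4 * lam + 1) * h / t := by ring

/-- **The `θ`-diagonal of GLSS 2026, Proposition 2 (first display)**: with `h = λ/L = 2πλ/log T`,
`∫_0^T ((θ(t+h) − θ(t))/π)² dt = λ²T + O(λ²T/L) + O_λ(1)`, rendered with an ABSOLUTE constant
and the `O_λ(1)` absorbed by a term `T` (threshold depending on `λ`):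
`|∫_0^T ((θ(t+h) − θ(t))/π)² dt − λ²T| ≤ 4(λ²T/L + T)` for all large `T`. This is the
`(Δθ/π)²`-part of `∫_0^T (N(t+h) − N(t))² = λ²T + O(λ²T/L) + ∫_0^T (S(t+h) − S(t))² + O(L²)`
(`N = θ/π + 1 + S`): `(θ(t+h) − θ(t))/π = λ(log t − log 2π)/log T + O(h/t)` on `[1, T]`
(`abs_theta_window_sub_le`), `∫_1^T (log t − log 2π)² dt` by its antiderivative, `θ` bounded on
`[0, 2]`. Our decomposition (a gloss on the printed "Combining" step; [GLSS1] §4 is not held).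
[cite: GoldstonLeeSchettlerSuriajaya2026, §3 Proposition 2] -/
theorem abs_integral_thetaWindow_sq_sub_le :
    ∃ A : ℝ, ∀ lam : ℝ, 0 < lam → ∀ᶠ T : ℝ in atTop,
      |(∫ t in (0 : ℝ)..T,
          ((riemannSiegelTheta (t + lam / L T) - riemannSiegelTheta t) / π) ^ 2) - lam ^ 2 * T| ≤
        A * (lam ^ 2 * T / L T + T) := by
  have hπ : 0 < π := Real.pi_pos
  have hπ3 : 3 < π := Real.pi_gt_three
  have hθc : Continuous riemannSiegelTheta := continuous_riemannSiegelTheta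
  -- a bound for θ on [0, 2]
  obtain ⟨M₀, hM₀⟩ := (isCompact_Icc (a := (0 : ℝ)) (b := 2)).exists_bound_of_continuousOn
    hθc.continuousOn
  have hM₀0 : 0 ≤ M₀ := (norm_nonneg _).trans (hM₀ 0 (by simp))
  set c : ℝ := Real.log (2 * π) with hc_def
  have hc2 : c < 2 := SelbergFujii.log_two_pi_lt_two
  have hc0 : 0 ≤ c := Real.log_nonneg (by linarith)
  refine ⟨4, fun lam hlam ↦ ?_⟩
  filter_upwards [eventually_ge_atTop (Real.exp (2 * π * lam)), eventually_ge_atTop (Real.exp 2),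
    eventually_ge_atTop (M₀ ^ 2 + 2 * π * lam * (4 * lam + 1) + 10 * lam ^ 2)]
    with T hT1 hT2 hT3
  have hT0 : 0 < T := lt_of_lt_of_le (Real.exp_pos 2) hT2
  have hlogT : 2 ≤ Real.log T := by
    rw [← Real.log_exp 2]; exact Real.log_le_log (Real.exp_pos 2) hT2
  have hlog0 : 0 < Real.log T := by linarith
  have hT1' : 1 ≤ T := by
    have := Real.add_one_le_exp (2 : ℝ); linarith
  have hlogT' : 2 * π * lam ≤ Real.log T := by
    rw [← Real.log_exp (2 * π * lam)]; exact Real.log_le_log (Real.exp_pos _) hT1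
  have hL : L T = Real.log T / (2 * π) := rfl
  have hLpos : 0 < L T := L_pos (by linarith [Real.add_one_le_exp (2:ℝ)])
  -- h
  have hh : lam / L T = 2 * π * lam / Real.log T := by rw [hL]; field_simp
  set h : ℝ := 2 * π * lam / Real.log T with hh_def
  have hh0 : 0 < h := by positivity
  have hh1 : h ≤ 1 := by rw [hh_def, div_le_one hlog0]; exact hlogT'
  rw [hh]
  -- the integrand and its pieces
  set f : ℝ → ℝ := fun t ↦ ((riemannSiegelTheta (t + h) - riemannSiegelTheta t) / π) ^ 2 with hf
  set m2 : ℝ → ℝ := fun t ↦ (lam / Real.log T * (Real.log t - c)) ^ 2 with hm2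
  have hfc : Continuous f := by
    rw [hf]; fun_prop
  have hfi : ∀ a b : ℝ, IntervalIntegrable f volume a b := fun a b ↦ hfc.intervalIntegrable a b
  have hm2c : ContinuousOn m2 (Set.Icc 1 T) := by
    rw [hm2]
    refine ContinuousOn.pow (continuousOn_const.mul ((Real.continuousOn_log.mono ?_).sub
      continuousOn_const)) 2
    intro x hx; simp; linarith [hx.1]
  have hm2i : IntervalIntegrable m2 volume 1 T := by
    refine ContinuousOn.intervalIntegrable ?_; rwa [Set.uIcc_of_le hT1']
  -- split ∫_0^T f = ∫_0^1 f + ∫_1^T f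
  have e1 : ∫ t in (0 : ℝ)..T, f t = (∫ t in (0 : ℝ)..1, f t) + ∫ t in (1 : ℝ)..T, f t :=
    (intervalIntegral.integral_add_adjacent_intervals (hfi 0 1) (hfi 1 T)).symm
  -- ∫_0^1 f ∈ [0, M₀²]
  have b0 : 0 ≤ ∫ t in (0 : ℝ)..1, f t :=
    intervalIntegral.integral_nonneg (by norm_num) fun t _ ↦ by rw [hf]; positivity
  have b1 : ∫ t in (0 : ℝ)..1, f t ≤ M₀ ^ 2 := by
    have hle := intervalIntegral.integral_mono_on (by norm_num : (0 : ℝ) ≤ 1) (hfi 0 1)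
      (continuous_const.intervalIntegrable _ _) (g := fun _ ↦ M₀ ^ 2) fun t ht ↦ by
        rw [hf]; simp only
        have h1 := hM₀ (t + h) ⟨by linarith [ht.1], by linarith [ht.2]⟩
        have h2 := hM₀ t ⟨ht.1, by linarith [ht.2]⟩
        rw [Real.norm_eq_abs] at h1 h2
        have h3 : |(riemannSiegelTheta (t + h) - riemannSiegelTheta t) / π| ≤ M₀ := by
          rw [abs_div, abs_of_pos hπ, div_le_iff₀ hπ]
          calc |riemannSiegelTheta (t + h) - riemannSiegelTheta t|
              ≤ |riemannSiegelTheta (t + h)| + |riemannSiegelTheta t| := abs_sub _ _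
            _ ≤ M₀ + M₀ := add_le_add h1 h2
            _ ≤ M₀ * π := by nlinarith
        calc ((riemannSiegelTheta (t + h) - riemannSiegelTheta t) / π) ^ 2
            = |(riemannSiegelTheta (t + h) - riemannSiegelTheta t) / π| ^ 2 := (sq_abs _).symm
          _ ≤ M₀ ^ 2 := pow_le_pow_left₀ (abs_nonneg _) h3 2
    refine hle.trans ?_
    rw [intervalIntegral.integral_const, smul_eq_mul]; linarith
  -- ∫_1^T f = ∫_1^T m2 + ∫_1^T (f − m2)
  have e2 : ∫ t in (1 : ℝ)..T, f t =
      (∫ t in (1 : ℝ)..T, m2 t) + ∫ t in (1 : ℝ)..T, (f t - m2 t) := by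
    rw [← intervalIntegral.integral_add hm2i ((hfi 1 T).sub hm2i)]
    refine intervalIntegral.integral_congr fun t _ ↦ ?_
    ring
  -- |∫_1^T (f − m2)| ≤ (4λ+1) h log T = 2πλ(4λ+1)
  have b2 : |∫ t in (1 : ℝ)..T, (f t - m2 t)| ≤ 2 * π * lam * (4 * lam + 1) := by
    have hb := intervalIntegral.norm_integral_le_of_norm_le (μ := volume)
      (f := fun t ↦ f t - m2 t) (g := fun t ↦ (4 * lam + 1) * h * (1 / t)) hT1'
      (ae_of_all _ fun t ht ↦ ?_) ?_
    · rw [Real.norm_eq_abs] at hb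
      refine hb.trans (le_of_eq ?_)
      rw [intervalIntegral.integral_const_mul, integral_one_div (by
        rw [Set.uIcc_of_le hT1']; intro h0; exact absurd h0.1 (by norm_num)), div_one, hh_def]
      field_simp
    · rw [Real.norm_eq_abs, hf, hm2]
      simp only
      have := abs_thetaWindow_sq_sub_le hlam hlogT hh1 ht.1.le ht.2
      rw [← hh_def] at this
      calc _ ≤ (4 * lam + 1) * h / t := this
        _ = (4 * lam + 1) * h * (1 / t) := by ring
    · refine ContinuousOn.intervalIntegrable ?_
      rw [Set.uIcc_of_le hT1']
      refine continuousOn_const.mul (continuousOn_const.div continuousOn_id fun x hx ↦ ?_)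
      simp at hx ⊢; linarith [hx.1]
  -- ∫_1^T m2 = (λ/log T)² · [antiderivative]
  have e3 : ∫ t in (1 : ℝ)..T, m2 t = (lam / Real.log T) ^ 2 *
      ((T * (Real.log T - c) ^ 2 - 2 * T * (Real.log T - c) + 2 * T) - (c ^ 2 + 2 * c + 2)) := by
    rw [hm2]
    simp only [mul_pow]
    rw [intervalIntegral.integral_const_mul, integral_logSq c hT1']
  -- the main-term algebra: |∫_1^T m2 − λ²T| ≤ 16 λ²T/log T + 10 λ²
  have b3 : |(∫ t in (1 : ℝ)..T, m2 t) - lam ^ 2 * T| ≤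
      16 * (lam ^ 2 * T / Real.log T) + 10 * lam ^ 2 := by
    rw [e3]
    exact mainTerm_algebra (by linarith) hT0.le hc0 hc2.le
  -- 16 λ²T/log T = (16/2π) λ²T/L ≤ 3 λ²T/L
  have b4 : 16 * (lam ^ 2 * T / Real.log T) ≤ 3 * (lam ^ 2 * T / L T) := by
    have e4 : lam ^ 2 * T / L T = 2 * π * (lam ^ 2 * T / Real.log T) := by
      rw [hL]; field_simp
    rw [e4]
    have hX : 0 ≤ lam ^ 2 * T / Real.log T := by positivity
    nlinarith [hX, hπ3]
  -- assemble
  have hq : 0 ≤ lam ^ 2 * T / L T := by positivity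
  rw [e1, e2, abs_le]
  have hb2 := abs_le.mp b2
  have hb3 := abs_le.mp b3
  constructor <;> linarith [hb2.1, hb2.2, hb3.1, hb3.2, b0, b1, b4, hT3, hq]

end GLSS2026

/-- **GLSS 2026, Proposition 1 (Gallagher and Mueller), asymptotic form.** "For `λ > 0`, we have,
as `T → ∞`, `∫_0^T (N(t + λ/L) − N(t))² dt = 𝒮(T, λ) + O(L²)`." For each fixed `λ > 0` there is
`C` (depending on `λ`) with `|𝒮(T, λ) − ∫_0^T (N(t + λ/L) − N(t))² dt| ≤ C log T` for all large
`T` — from the explicit edge form, `N(h) ≤ N(1)` for `h = λ/L ≤ 1` and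
`N(T+h) − N(T−h) ≤ N(T+1) − N(T−1) ≤ 2K₁ log T` (Riemann–von Mangoldt, tree
`SelbergFujii.exists_zetaZeroCount_add_one_sub_le`). This is `O(L)`, hence the printed `O(L²)`.
[cite: GoldstonLeeSchettlerSuriajaya2026, §3 Proposition 1] -/
theorem glss2026_proposition1 {lam : ℝ} (hlam : 0 < lam) :
    ∃ C : ℝ, ∀ᶠ T : ℝ in atTop,
      |GLSS2026.secondMomentSum T lam -
          ∫ t in (0 : ℝ)..T, ((zetaZeroCount (t + lam / GLSS2026.L T) : ℝ) - zetaZeroCount t) ^ 2| ≤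
        C * Real.log T := by
  obtain ⟨K₁, hK₁, T₀, hT₀, hK⟩ := SelbergFujii.exists_zetaZeroCount_add_one_sub_le
  refine ⟨2 * π * lam * ((zetaZeroCount 1 : ℝ) ^ 2 + 4 * K₁ ^ 2), ?_⟩
  filter_upwards [eventually_ge_atTop (T₀ + 2), eventually_ge_atTop (Real.exp (2 * π * lam)),
    eventually_ge_atTop (Real.exp 1)] with T hT1 hT2 hT3
  have hπ : 0 < π := Real.pi_pos
  have hT : 1 < T := by linarith
  have hlog1 : 1 ≤ Real.log T := by
    rw [← Real.log_exp 1]; exact Real.log_le_log (Real.exp_pos 1) hT3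
  have hlogT : 2 * π * lam ≤ Real.log T := by
    rw [← Real.log_exp (2 * π * lam)]; exact Real.log_le_log (Real.exp_pos _) hT2
  have hLT : GLSS2026.L T = Real.log T / (2 * π) := rfl
  have hL : 0 < GLSS2026.L T := GLSS2026.L_pos hT
  -- h = 2πλ / log T ≤ 1
  have hh : lam / GLSS2026.L T = 2 * π * lam / Real.log T := by
    rw [hLT]; field_simp
  have hh1 : lam / GLSS2026.L T ≤ 1 := by
    rw [hh, div_le_one (by linarith)]; exact hlogT
  have hh0 : 0 < lam / GLSS2026.L T := div_pos hlam hL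
  have hmono : ∀ {x y : ℝ}, x ≤ y → (zetaZeroCount x : ℝ) ≤ zetaZeroCount y := fun hxy ↦ by
    exact_mod_cast zetaZeroCount_mono hxy
  have hedge := GLSS2026.abs_secondMomentSum_sub_integral_le hT hlam (by linarith)
  refine hedge.trans ?_
  -- A ≤ N(1), B ≤ 2 K₁ log T
  have hA : (zetaZeroCount (lam / GLSS2026.L T) : ℝ) ≤ zetaZeroCount 1 := hmono hh1
  have hA0 : (0 : ℝ) ≤ zetaZeroCount (lam / GLSS2026.L T) := Nat.cast_nonneg _
  have hB1 := hK T (by linarith)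
  have hB2 := hK (T - 1) (by linarith)
  rw [sub_add_cancel] at hB2
  have hlogm : Real.log (T - 1) ≤ Real.log T := Real.log_le_log (by linarith) (by linarith)
  have hB : (zetaZeroCount (T + lam / GLSS2026.L T) : ℝ) - zetaZeroCount (T - lam / GLSS2026.L T) ≤
      2 * K₁ * Real.log T := by
    have h1 := hmono (by linarith : T + lam / GLSS2026.L T ≤ T + 1)
    have h2 := hmono (by linarith : T - 1 ≤ T - lam / GLSS2026.L T)
    nlinarith
  have hB0 : 0 ≤ (zetaZeroCount (T + lam / GLSS2026.L T) : ℝ) - zetaZeroCount (T - lam / GLSS2026.L T) := by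
    linarith [hmono (by linarith : T - lam / GLSS2026.L T ≤ T + lam / GLSS2026.L T)]
  have hsqA : (zetaZeroCount (lam / GLSS2026.L T) : ℝ) ^ 2 ≤ (zetaZeroCount 1 : ℝ) ^ 2 :=
    pow_le_pow_left₀ hA0 hA 2
  have hsqB : ((zetaZeroCount (T + lam / GLSS2026.L T) : ℝ) - zetaZeroCount (T - lam / GLSS2026.L T)) ^ 2 ≤
      (2 * K₁ * Real.log T) ^ 2 := pow_le_pow_left₀ hB0 hB 2
  rw [hh]
  have hlog0 : 0 < Real.log T := by linarith
  calc 2 * π * lam / Real.log T * ((zetaZeroCount (2 * π * lam / Real.log T) : ℝ) ^ 2 +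
        ((zetaZeroCount (T + 2 * π * lam / Real.log T) : ℝ) -
          zetaZeroCount (T - 2 * π * lam / Real.log T)) ^ 2)
      ≤ 2 * π * lam / Real.log T * ((zetaZeroCount 1 : ℝ) ^ 2 + (2 * K₁ * Real.log T) ^ 2) := by
        rw [← hh]
        exact mul_le_mul_of_nonneg_left (add_le_add hsqA hsqB) (by positivity)
    _ = 2 * π * lam * ((zetaZeroCount 1 : ℝ) ^ 2 / Real.log T + 4 * K₁ ^ 2 * Real.log T) := by
        field_simp
        ring
    _ ≤ 2 * π * lam * ((zetaZeroCount 1 : ℝ) ^ 2 + 4 * K₁ ^ 2) * Real.log T := by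
        have h1 : (zetaZeroCount 1 : ℝ) ^ 2 / Real.log T ≤ (zetaZeroCount 1 : ℝ) ^ 2 * Real.log T := by
          rw [div_le_iff₀ hlog0]
          have hN : 0 ≤ (zetaZeroCount 1 : ℝ) ^ 2 := by positivity
          have hl2 : 1 ≤ Real.log T * Real.log T := by nlinarith
          calc (zetaZeroCount 1 : ℝ) ^ 2 = (zetaZeroCount 1 : ℝ) ^ 2 * 1 := by ring
            _ ≤ (zetaZeroCount 1 : ℝ) ^ 2 * (Real.log T * Real.log T) :=
                mul_le_mul_of_nonneg_left hl2 hN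
            _ = (zetaZeroCount 1 : ℝ) ^ 2 * Real.log T * Real.log T := by ring
        have h2 : 0 ≤ 2 * π * lam := by positivity
        nlinarith

/-! ### Proposition 2, second display, in the tree's binder shape for Fujii's (9.25.2) -/

/-- Numerics: `log(3 + 2πλ) ≤ 4 log(2 + λ)` for `λ > 0` (`3 + 2πλ ≤ (2 + λ)⁴`). [folklore] -/
private theorem log_three_add_le {lam : ℝ} (hlam : 0 < lam) :
    Real.log (3 + 2 * π * lam) ≤ 4 * Real.log (2 + lam) := by
  have hπ : π < 4 := Real.pi_lt_four
  have hπ0 : 0 < π := Real.pi_pos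
  -- 3 + 2πλ ≤ (2+λ)^4 : indeed (2+λ)^4 ≥ 16 + 32λ ≥ 3 + 8λ ≥ 3 + 2πλ
  have h1 : 3 + 2 * π * lam ≤ (2 + lam) ^ 4 := by nlinarith [sq_nonneg lam, sq_nonneg (lam + 2)]
  calc Real.log (3 + 2 * π * lam) ≤ Real.log ((2 + lam) ^ 4) :=
        Real.log_le_log (by positivity) h1
    _ = 4 * Real.log (2 + lam) := by rw [Real.log_pow]; norm_num

/-- **GLSS 2026, Proposition 2, second display, from Fujii's mean square (Titchmarsh (9.25.2)).**
"`∫_0^T (S(t + λ/L) − S(t))² dt = (T/π²) log(2 + λ) + O(T √log(2 + λ))`" (GLSS 2026, §3,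
Proposition 2, attributed there to Gallagher–Mueller [GaMu78], Fujii [Fu74, Fu81], Tsang [Tsang84]),
here DERIVED from the mean-square asymptotic (9.25.2)
`∫_0^T |S(t+h) − S(t)|² dt = π⁻² T log(3 + h log T) + O(T √log(3 + h log T))` (uniformly in
`0 ≤ h ≤ T/2`), taken as a HYPOTHESIS in exactly the binder shape of the tree's
`SelbergFujii.first_moment_of_moments` (the tree does not vendor (9.25.2) as a named fact; its
remaining analytic input is Selberg's mean-value theorem, see `SelbergFujiiApproxFormula.lean`).
Our bookkeeping (a gloss): with `h = λ/L = 2πλ/log T`, `h log T = 2πλ`;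
`0 ≤ log(3 + 2πλ) − log(2 + λ) = log((3+2πλ)/(2+λ)) ≤ log 2π < 2` and `2/π² ≤ 6 log 2 ≤ 6√log(2+λ)`;
`log(3 + 2πλ) ≤ 4 log(2 + λ)`, so `√log(3+2πλ) ≤ 2√log(2+λ)`. The constant is ABSOLUTE
(`A₁ = 2|A| + 6`); the threshold (`T ≥ T₀`, `log T ≥ 4πλ`, `T ≥ 2`) depends on `λ`, as printed
("for `λ > 0`, as `T → ∞`"). [cite: GoldstonLeeSchettlerSuriajaya2026, §3 Proposition 2] -/
theorem glss2026_proposition2b_of_fujii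
    (h252 : ∃ A : ℝ, ∃ T₀ : ℝ, ∀ T : ℝ, T₀ ≤ T → ∀ h : ℝ, 0 ≤ h → h ≤ T / 2 →
      |(∫ t in (0 : ℝ)..T, (zetaArgS (t + h) - zetaArgS t) ^ 2) -
          T * Real.log (3 + h * Real.log T) / π ^ 2| ≤
        A * (T * Real.sqrt (Real.log (3 + h * Real.log T)))) :
    ∃ A₁ : ℝ, ∀ lam : ℝ, 0 < lam → ∀ᶠ T : ℝ in atTop,
      |(∫ t in (0 : ℝ)..T, (zetaArgS (t + lam / GLSS2026.L T) - zetaArgS t) ^ 2) -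
          T / π ^ 2 * Real.log (2 + lam)| ≤
        A₁ * (T * Real.sqrt (Real.log (2 + lam))) := by
  obtain ⟨A, T₀, hA⟩ := h252
  refine ⟨2 * |A| + 6, fun lam hlam ↦ ?_⟩
  filter_upwards [eventually_ge_atTop T₀, eventually_ge_atTop (Real.exp (4 * π * lam)),
    eventually_ge_atTop (2 : ℝ)] with T hT0 hT1 hT2
  have hπ0 : 0 < π := Real.pi_pos
  have hπ3 : 3 < π := Real.pi_gt_three
  have hlogT : 4 * π * lam ≤ Real.log T := by
    rw [← Real.log_exp (4 * π * lam)]; exact Real.log_le_log (Real.exp_pos _) hT1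
  have hlog0 : 0 < Real.log T := by nlinarith
  have hL : GLSS2026.L T = Real.log T / (2 * π) := rfl
  -- h = 2πλ / log T
  have hh : lam / GLSS2026.L T = 2 * π * lam / Real.log T := by rw [hL]; field_simp
  have hh0 : 0 ≤ 2 * π * lam / Real.log T := by positivity
  have hh1 : 2 * π * lam / Real.log T ≤ 1 / 2 := by
    rw [div_le_iff₀ hlog0]; linarith
  have hhT : 2 * π * lam / Real.log T ≤ T / 2 := by linarith
  have hmain := hA T hT0 _ hh0 hhT
  have e1 : 2 * π * lam / Real.log T * Real.log T = 2 * π * lam := by field_simp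
  rw [e1] at hmain
  rw [hh]
  -- compare the two main terms and the two square roots
  have hl2 : 0 < Real.log (2 + lam) := Real.log_pos (by linarith)
  have hl2' : Real.log 2 ≤ Real.log (2 + lam) := Real.log_le_log (by norm_num) (by linarith)
  have hlog2 : (0.6931471803 : ℝ) < Real.log 2 := Real.log_two_gt_d9
  have hs0 : 0 < Real.sqrt (Real.log (2 + lam)) := Real.sqrt_pos.mpr hl2
  have h4 := log_three_add_le hlam
  have hge : Real.log (2 + lam) ≤ Real.log (3 + 2 * π * lam) :=
    Real.log_le_log (by linarith) (by nlinarith)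
  -- √log(3+2πλ) ≤ 2 √log(2+λ)
  have hsqrt : Real.sqrt (Real.log (3 + 2 * π * lam)) ≤ 2 * Real.sqrt (Real.log (2 + lam)) := by
    rw [show (2 : ℝ) * Real.sqrt (Real.log (2 + lam)) = Real.sqrt (4 * Real.log (2 + lam)) by
      rw [Real.sqrt_mul (by norm_num), show Real.sqrt 4 = 2 by
        rw [show (4 : ℝ) = 2 ^ 2 by norm_num, Real.sqrt_sq (by norm_num)]]]
    exact Real.sqrt_le_sqrt h4
  -- main-term difference: log((3+2πλ)/(2+λ)) ≤ log 2π < 2, and 2/π² ≤ 6 log 2 ≤ 6 √log(2+λ)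
  have hratio : Real.log (3 + 2 * π * lam) - Real.log (2 + lam) ≤ 2 := by
    rw [← Real.log_div (by nlinarith) (by linarith)]
    have hq : (3 + 2 * π * lam) / (2 + lam) ≤ 2 * π := by
      rw [div_le_iff₀ (by linarith)]; nlinarith
    calc Real.log ((3 + 2 * π * lam) / (2 + lam)) ≤ Real.log (2 * π) :=
          Real.log_le_log (by positivity) hq
      _ ≤ 2 := (SelbergFujii.log_two_pi_lt_two).le
  have hsl : Real.log 2 ≤ Real.sqrt (Real.log (2 + lam)) := by
    -- log 2 ≤ √log 2 ≤ √log(2+λ)  (log 2 < 1)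
    have hlt1 : Real.log 2 < 1 := by
      have := Real.log_two_lt_d9; linarith
    calc Real.log 2 ≤ Real.sqrt (Real.log 2) := by
          conv_lhs => rw [← Real.sqrt_sq (by linarith : (0 : ℝ) ≤ Real.log 2)]
          exact Real.sqrt_le_sqrt (by nlinarith)
      _ ≤ Real.sqrt (Real.log (2 + lam)) := Real.sqrt_le_sqrt hl2'
  -- assemble
  have hT : 0 ≤ T := by linarith
  have hπ2 : 9 < π ^ 2 := by nlinarith
  have eM : (∫ t in (0 : ℝ)..T, (zetaArgS (t + 2 * π * lam / Real.log T) - zetaArgS t) ^ 2) -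
      T / π ^ 2 * Real.log (2 + lam) =
      ((∫ t in (0 : ℝ)..T, (zetaArgS (t + 2 * π * lam / Real.log T) - zetaArgS t) ^ 2) -
        T * Real.log (3 + 2 * π * lam) / π ^ 2) +
      T / π ^ 2 * (Real.log (3 + 2 * π * lam) - Real.log (2 + lam)) := by ring
  rw [eM]
  refine (abs_add_le _ _).trans ?_
  have hA' : |A| * (T * Real.sqrt (Real.log (3 + 2 * π * lam))) ≤
      2 * |A| * (T * Real.sqrt (Real.log (2 + lam))) := by
    have : T * Real.sqrt (Real.log (3 + 2 * π * lam)) ≤ T * (2 * Real.sqrt (Real.log (2 + lam))) :=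
      mul_le_mul_of_nonneg_left hsqrt hT
    nlinarith [abs_nonneg A]
  have h1 : |(∫ t in (0 : ℝ)..T, (zetaArgS (t + 2 * π * lam / Real.log T) - zetaArgS t) ^ 2) -
      T * Real.log (3 + 2 * π * lam) / π ^ 2| ≤ 2 * |A| * (T * Real.sqrt (Real.log (2 + lam))) := by
    refine hmain.trans (le_trans ?_ hA')
    exact mul_le_mul_of_nonneg_right (le_abs_self A) (by positivity)
  have h2 : |T / π ^ 2 * (Real.log (3 + 2 * π * lam) - Real.log (2 + lam))| ≤
      6 * (T * Real.sqrt (Real.log (2 + lam))) := by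
    rw [abs_of_nonneg (by
      have : 0 ≤ Real.log (3 + 2 * π * lam) - Real.log (2 + lam) := by linarith
      positivity)]
    -- T/π² · diff ≤ T/9 · 2 ≤ T · 6 · log 2 ≤ 6 T √log(2+λ)
    have hd0 : 0 ≤ Real.log (3 + 2 * π * lam) - Real.log (2 + lam) := by linarith
    have : T / π ^ 2 * (Real.log (3 + 2 * π * lam) - Real.log (2 + lam)) ≤ T / 9 * 2 := by
      have hπ2' : T / π ^ 2 ≤ T / 9 := div_le_div_of_nonneg_left hT (by norm_num) hπ2.le
      calc T / π ^ 2 * (Real.log (3 + 2 * π * lam) - Real.log (2 + lam))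
          ≤ T / 9 * (Real.log (3 + 2 * π * lam) - Real.log (2 + lam)) :=
            mul_le_mul_of_nonneg_right hπ2' hd0
        _ ≤ T / 9 * 2 := mul_le_mul_of_nonneg_left hratio (by positivity)
    nlinarith
  linarith

/-! ### Assembly: (3.2) = `glss2026_dsec2` from Proposition 1, Proposition 2 (first display, as a
hypothesis) and Fujii's (9.25.2) (as a hypothesis) -/

/-- **GLSS 2026, (3.2) "(Dsec2)" assembled** ("Combining the two results, we have for any `λ > 0`,
as `T → ∞`, `𝒮(T,λ) − λ²T = ∫_0^T (S(t+λ/L) − S(t))² dt + O(λ²T/L) + O(L²)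
= (T/π²) log(2+λ) + O(T√log(2+λ)) + O(λ²T/L)`"): the named fact `glss2026_dsec2` follows from
(P1) = `glss2026_proposition1` (PROVED above), (P2b) = `glss2026_proposition2b_of_fujii` (PROVED
above from Fujii's (9.25.2) as the hypothesis `h252`), and the FIRST display of Proposition 2 taken
as the hypothesis `h2a` — in the WEAKENED rendering `|∫_0^T (N(t+λ/L) − N(t))² − λ²T −
∫_0^T (S(t+λ/L) − S(t))²| ≤ A₂ (λ²T/L + T)` (absolute `A₂`, threshold depending on `λ`; the
printed `O(L²)` is replaced by the cruder `O(T)`, which is all the assembly uses since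
`T ≤ T√log(2+λ)/√log 2`). Constants: `A₀ = A₂ + (A₂ + 2)·2 + A₁` (using `1/√log 2 ≤ 2`).
Remaining input for an outright `glss2026_dsec2_holds`: a proof of `h2a` (Riemann–von Mangoldt
algebra with the `θ`-calculus and `sup |S| ≪ log t`; rh-crit/ah MEMO-t6-dsec2-road.md) and of
`h252` (Selberg–Fujii; the tree's open analytic input of the Selberg–Fujii cluster).
[cite: GoldstonLeeSchettlerSuriajaya2026, §3 eq. (3.2)] -/
theorem glss2026_dsec2_of_prop2a_of_fujii
    (h2a : ∃ A₂ : ℝ, ∀ lam : ℝ, 0 < lam → ∀ᶠ T : ℝ in atTop,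
      |(∫ t in (0 : ℝ)..T,
            ((zetaZeroCount (t + lam / GLSS2026.L T) : ℝ) - zetaZeroCount t) ^ 2) -
          lam ^ 2 * T -
          ∫ t in (0 : ℝ)..T, (zetaArgS (t + lam / GLSS2026.L T) - zetaArgS t) ^ 2| ≤
        A₂ * (lam ^ 2 * T / GLSS2026.L T + T))
    (h252 : ∃ A : ℝ, ∃ T₀ : ℝ, ∀ T : ℝ, T₀ ≤ T → ∀ h : ℝ, 0 ≤ h → h ≤ T / 2 →
      |(∫ t in (0 : ℝ)..T, (zetaArgS (t + h) - zetaArgS t) ^ 2) -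
          T * Real.log (3 + h * Real.log T) / π ^ 2| ≤
        A * (T * Real.sqrt (Real.log (3 + h * Real.log T)))) :
    glss2026_dsec2 := by
  obtain ⟨A₂, h2a⟩ := h2a
  obtain ⟨A₁, h2b⟩ := glss2026_proposition2b_of_fujii h252
  -- A₂, A₁ ≥ 0 WLOG
  have hA₂ : ∀ lam : ℝ, 0 < lam → ∀ᶠ T : ℝ in atTop,
      |(∫ t in (0 : ℝ)..T,
            ((zetaZeroCount (t + lam / GLSS2026.L T) : ℝ) - zetaZeroCount t) ^ 2) -
          lam ^ 2 * T -
          ∫ t in (0 : ℝ)..T, (zetaArgS (t + lam / GLSS2026.L T) - zetaArgS t) ^ 2| ≤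
        |A₂| * (lam ^ 2 * T / GLSS2026.L T + T) := by
    intro lam hlam
    filter_upwards [h2a lam hlam, eventually_gt_atTop (1 : ℝ)] with T hT hT1
    refine hT.trans (mul_le_mul_of_nonneg_right (le_abs_self _) ?_)
    have := GLSS2026.L_pos hT1
    positivity
  refine ⟨|A₂| + (|A₂| + 2) * 2 + |A₁|, fun lam hlam ↦ ?_⟩
  obtain ⟨C, hC⟩ := glss2026_proposition1 hlam
  -- `C log T ≤ T` eventually
  have hlogT : ∀ᶠ T : ℝ in atTop, |C| * Real.log T ≤ T := by
    have h := (Real.isLittleO_log_id_atTop.const_mul_left |C|).def zero_lt_one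
    filter_upwards [h, eventually_gt_atTop (1 : ℝ)] with T hT hT1
    have hl : 0 ≤ Real.log T := Real.log_nonneg hT1.le
    have e1 : ‖|C| * Real.log T‖ = |C| * Real.log T := by
      rw [Real.norm_eq_abs, abs_of_nonneg (mul_nonneg (abs_nonneg C) hl)]
    have e2 : (1 : ℝ) * ‖id T‖ = T := by
      rw [id, Real.norm_eq_abs, abs_of_pos (by linarith), one_mul]
    linarith [hT, e1, e2]
  filter_upwards [hC, hA₂ lam hlam, h2b lam hlam, eventually_gt_atTop (1 : ℝ), hlogT]
    with T h1 h2 h3 hT1 h4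
  have hL : 0 < GLSS2026.L T := GLSS2026.L_pos hT1
  have hT0 : 0 < T := by linarith
  -- √log(2+λ) ≥ √log 2 ≥ 1/2
  have hs : 1 / 2 ≤ Real.sqrt (Real.log (2 + lam)) := by
    have hlog2 : (0.6931471803 : ℝ) < Real.log 2 := Real.log_two_gt_d9
    have h22 : Real.log 2 ≤ Real.log (2 + lam) := Real.log_le_log (by norm_num) (by linarith)
    rw [show (1 : ℝ) / 2 = Real.sqrt (1 / 4) by
      rw [show (1 : ℝ) / 4 = (1 / 2) ^ 2 by norm_num, Real.sqrt_sq (by norm_num)]]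
    exact Real.sqrt_le_sqrt (by linarith)
  have hs0 : 0 ≤ Real.sqrt (Real.log (2 + lam)) := Real.sqrt_nonneg _
  -- triangle inequality
  have h1' : |GLSS2026.secondMomentSum T lam -
      ∫ t in (0 : ℝ)..T,
        ((zetaZeroCount (t + lam / GLSS2026.L T) : ℝ) - zetaZeroCount t) ^ 2| ≤ T := by
    refine h1.trans (le_trans ?_ h4)
    exact mul_le_mul_of_nonneg_right (le_abs_self C) (Real.log_nonneg hT1.le)
  have h3' : |(∫ t in (0 : ℝ)..T, (zetaArgS (t + lam / GLSS2026.L T) - zetaArgS t) ^ 2) -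
      T / π ^ 2 * Real.log (2 + lam)| ≤ |A₁| * (T * Real.sqrt (Real.log (2 + lam))) :=
    h3.trans (mul_le_mul_of_nonneg_right (le_abs_self _) (by positivity))
  have key : |GLSS2026.secondMomentSum T lam - lam ^ 2 * T - T / π ^ 2 * Real.log (2 + lam)| ≤
      T + |A₂| * (lam ^ 2 * T / GLSS2026.L T + T) + |A₁| * (T * Real.sqrt (Real.log (2 + lam))) := by
    have e : GLSS2026.secondMomentSum T lam - lam ^ 2 * T - T / π ^ 2 * Real.log (2 + lam) =
        (GLSS2026.secondMomentSum T lam -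
          ∫ t in (0 : ℝ)..T,
            ((zetaZeroCount (t + lam / GLSS2026.L T) : ℝ) - zetaZeroCount t) ^ 2) +
        ((∫ t in (0 : ℝ)..T,
            ((zetaZeroCount (t + lam / GLSS2026.L T) : ℝ) - zetaZeroCount t) ^ 2) -
          lam ^ 2 * T -
          ∫ t in (0 : ℝ)..T, (zetaArgS (t + lam / GLSS2026.L T) - zetaArgS t) ^ 2) +
        ((∫ t in (0 : ℝ)..T, (zetaArgS (t + lam / GLSS2026.L T) - zetaArgS t) ^ 2) -
          T / π ^ 2 * Real.log (2 + lam)) := by ring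
    rw [e]
    exact (abs_add_three _ _ _).trans (add_le_add (add_le_add h1' h2) h3')
  refine key.trans ?_
  -- T ≤ 2 T √log(2+λ)
  have hT2 : T ≤ 2 * (T * Real.sqrt (Real.log (2 + lam))) := by nlinarith
  have hA2 : 0 ≤ |A₂| := abs_nonneg _
  have hA1 : 0 ≤ |A₁| := abs_nonneg _
  have hq : 0 ≤ lam ^ 2 * T / GLSS2026.L T := by positivity
  have hTs : 0 ≤ T * Real.sqrt (Real.log (2 + lam)) := by positivity
  nlinarith [mul_nonneg hA2 hTs, mul_nonneg hA2 hq]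

namespace GLSS2026

/-! ### The cross term `∫ (Δθ/π)·(ΔS)` of Proposition 2 -/

/-- `|S(t)| ≤ C log t` for `t ≥ U` (`U ≥ 1`; Titchmarsh Thm. 9.4, tree
`isBigO_zetaArgS_log_holds`). [cite: Titchmarsh1986, Thm. 9.4 (9.4.2)] -/
private theorem exists_abs_zetaArgS_le_mul_log' :
    ∃ C U : ℝ, 0 < C ∧ 1 ≤ U ∧ ∀ t : ℝ, U ≤ t → |zetaArgS t| ≤ C * Real.log t := by
  have h := isBigO_zetaArgS_log_holds
  rw [isBigO_zetaArgS_log, Asymptotics.isBigO_iff] at h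
  obtain ⟨c, hc⟩ := h
  obtain ⟨T, hT⟩ := Filter.eventually_atTop.1 (hc.and (Filter.eventually_ge_atTop (1 : ℝ)))
  refine ⟨max c 1, max T 1, by positivity, le_max_right _ _, fun t ht ↦ ?_⟩
  obtain ⟨h1, h2⟩ := hT t (le_trans (le_max_left _ _) ht)
  rw [Real.norm_eq_abs, Real.norm_eq_abs, abs_of_nonneg (Real.log_nonneg h2)] at h1
  exact h1.trans (mul_le_mul_of_nonneg_right (le_max_left _ _) (Real.log_nonneg h2))

/-- `S` is bounded on `[0, b]`: `|S(t)| ≤ N(b) + M/π + 1` with `M` a bound for `|θ|` there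
(`S = N − θ/π − 1`). [folklore] -/
private theorem exists_abs_zetaArgS_le_on (b : ℝ) :
    ∃ C₀ : ℝ, 0 ≤ C₀ ∧ ∀ t ∈ Set.Icc (0 : ℝ) b, |zetaArgS t| ≤ C₀ := by
  obtain ⟨M, hM⟩ := (isCompact_Icc (a := (0 : ℝ)) (b := b)).exists_bound_of_continuousOn
    continuous_riemannSiegelTheta.continuousOn
  have hπ : 0 < π := Real.pi_pos
  refine ⟨(zetaZeroCount b : ℝ) + |M| / π + 1, by positivity, fun t ht ↦ ?_⟩
  have h1 : (zetaZeroCount t : ℝ) ≤ zetaZeroCount b := by exact_mod_cast zetaZeroCount_mono ht.2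
  have h2 : |riemannSiegelTheta t| ≤ |M| := by
    have := hM t ht; rw [Real.norm_eq_abs] at this; exact this.trans (le_abs_self M)
  have h3 : (0 : ℝ) ≤ zetaZeroCount t := Nat.cast_nonneg _
  unfold zetaArgS
  rw [abs_le]
  have h4 : |riemannSiegelTheta t / π| ≤ |M| / π := by
    rw [abs_div, abs_of_pos hπ]; exact div_le_div_of_nonneg_right h2 hπ.le
  have h5 := abs_le.mp h4
  constructor <;> linarith [h5.1, h5.2]

/-- A bound for `|S|` on `[0, T + 1]` of size `O(log T)`: `|S(t)| ≤ C log(T + 1) + C₀`. [folklore]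
-/
private theorem exists_abs_zetaArgS_le_log :
    ∃ C C₀ : ℝ, 0 < C ∧ 0 ≤ C₀ ∧ ∀ T : ℝ, 1 ≤ T → ∀ t ∈ Set.Icc (0 : ℝ) (T + 1),
      |zetaArgS t| ≤ C * Real.log (T + 1) + C₀ := by
  obtain ⟨C, U, hC, hU, hlog⟩ := exists_abs_zetaArgS_le_mul_log'
  obtain ⟨C₀, hC₀, hcpt⟩ := exists_abs_zetaArgS_le_on U
  refine ⟨C, C₀, hC, hC₀, fun T hT t ht ↦ ?_⟩
  have hlog1 : 0 ≤ Real.log (T + 1) := Real.log_nonneg (by linarith)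
  rcases le_or_gt U t with hUt | hUt
  · have h1 := hlog t hUt
    have h2 : Real.log t ≤ Real.log (T + 1) := Real.log_le_log (by linarith) ht.2
    nlinarith
  · have := hcpt t ⟨ht.1, hUt.le⟩
    nlinarith

/-- The second difference of `θ` at scale `h ≤ 1`, `u ≥ 2`:
`|(θ(u+h) − θ(u)) − (θ(u) − θ(u−h))| ≤ 10h/u` (two windows against `(h/2) log(·/2π)` and
`log(u/(u−h)) ≤ h/(u−h)`). [cite: Titchmarsh1986, §4.17 (θ'(t) = ½ log(t/2π) + O(1/t))] -/
theorem abs_theta_secondDiff_le {u h : ℝ} (hu : 2 ≤ u) (hh : 0 ≤ h) (hh1 : h ≤ 1) :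
    |(riemannSiegelTheta (u + h) - riemannSiegelTheta u) -
        (riemannSiegelTheta u - riemannSiegelTheta (u - h))| ≤ 10 * h / u := by
  have hπ : 0 < π := Real.pi_pos
  have hu0 : 0 < u := by linarith
  have huh : 1 ≤ u - h := by linarith
  have huh0 : 0 < u - h := by linarith
  have h1 := abs_theta_window_sub_le (by linarith : (1 : ℝ) ≤ u) hh hh1
  have h2 := abs_theta_window_sub_le huh hh hh1
  rw [sub_add_cancel] at h2
  -- (h/2)(log(u/2π) − log((u−h)/2π)) ≤ h/u
  have hl : 0 ≤ Real.log (u / (2 * π)) - Real.log ((u - h) / (2 * π)) := by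
    rw [sub_nonneg]; exact Real.log_le_log (by positivity) (by gcongr; linarith)
  have hl2 : Real.log (u / (2 * π)) - Real.log ((u - h) / (2 * π)) ≤ 2 * h / u := by
    rw [← Real.log_div (by positivity) (by positivity),
      show u / (2 * π) / ((u - h) / (2 * π)) = u / (u - h) by field_simp]
    have := Real.log_le_sub_one_of_pos (show 0 < u / (u - h) by positivity)
    have h4 : u / (u - h) - 1 = h / (u - h) := by field_simp; ring
    have h5 : h / (u - h) ≤ 2 * h / u := by
      rw [div_le_div_iff₀ huh0 hu0]; nlinarith
    linarith
  have h6 : 3 * h / (u - h) ≤ 6 * h / u := by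
    rw [div_le_div_iff₀ huh0 hu0]; nlinarith
  -- combine
  have e : (riemannSiegelTheta (u + h) - riemannSiegelTheta u) -
      (riemannSiegelTheta u - riemannSiegelTheta (u - h)) =
      (riemannSiegelTheta (u + h) - riemannSiegelTheta u - h / 2 * Real.log (u / (2 * π))) -
      (riemannSiegelTheta u - riemannSiegelTheta (u - h) - h / 2 * Real.log ((u - h) / (2 * π))) +
      h / 2 * (Real.log (u / (2 * π)) - Real.log ((u - h) / (2 * π))) := by ring
  rw [e]
  refine (abs_add_le _ _).trans ?_
  refine (add_le_add (abs_sub _ _) le_rfl).trans ?_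
  rw [abs_of_nonneg (by positivity : 0 ≤ h / 2 * (Real.log (u / (2 * π)) -
    Real.log ((u - h) / (2 * π))))]
  have h7 : h / 2 * (Real.log (u / (2 * π)) - Real.log ((u - h) / (2 * π))) ≤ h / u := by
    have : h / 2 * (Real.log (u / (2 * π)) - Real.log ((u - h) / (2 * π))) ≤ h / 2 * (2 * h / u) :=
      mul_le_mul_of_nonneg_left hl2 (by positivity)
    have h8 : h / 2 * (2 * h / u) ≤ h / u := by
      rw [show h / 2 * (2 * h / u) = h * h / u by ring]
      exact div_le_div_of_nonneg_right (by nlinarith) hu0.le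
    linarith
  have e2 : (10 : ℝ) * h / u = 3 * h / u + 6 * h / u + h / u := by ring
  rw [e2]
  linarith

/-- On `1 ≤ t ≤ T` (`2 ≤ log T`, `h = 2πλ/log T ≤ 1`): `|θ(t+h) − θ(t)|/π ≤ 2λ + 1`. [cite:
GoldstonLeeSchettlerSuriajaya2026, §3 Proposition 2] -/
private theorem abs_thetaWindow_div_pi_le {T lam t : ℝ} (hlam : 0 < lam) (hlogT : 2 ≤ Real.log T)
    (hh1 : 2 * π * lam / Real.log T ≤ 1) (ht : 1 ≤ t) (htT : t ≤ T) :
    |(riemannSiegelTheta (t + 2 * π * lam / Real.log T) - riemannSiegelTheta t) / π| ≤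
      2 * lam + 1 := by
  have hπ : 0 < π := Real.pi_pos
  have hπ3 : 3 < π := Real.pi_gt_three
  have ht0 : 0 < t := by linarith
  have hlog0 : 0 < Real.log T := by linarith
  set h : ℝ := 2 * π * lam / Real.log T with hh_def
  have hh0 : 0 ≤ h := by positivity
  have hc2 : Real.log (2 * π) < 2 := SelbergFujii.log_two_pi_lt_two
  have hc0 : 0 ≤ Real.log (2 * π) := Real.log_nonneg (by linarith)
  have hd := abs_theta_window_sub_le ht hh0 hh1
  have hlogdiv : Real.log (t / (2 * π)) = Real.log t - Real.log (2 * π) :=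
    Real.log_div (ne_of_gt ht0) (by positivity)
  have hlt : Real.log t ≤ Real.log T := Real.log_le_log ht0 htT
  have hlt0 : 0 ≤ Real.log t := Real.log_nonneg ht
  -- |(h/2) log(t/2π)| ≤ 2πλ
  have hm : |h / 2 * Real.log (t / (2 * π))| ≤ 2 * π * lam := by
    rw [abs_mul, abs_of_nonneg (by positivity : 0 ≤ h / 2), hlogdiv]
    have h1 : |Real.log t - Real.log (2 * π)| ≤ 2 * Real.log T := by
      rw [abs_le]; constructor <;> linarith
    calc h / 2 * |Real.log t - Real.log (2 * π)| ≤ h / 2 * (2 * Real.log T) :=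
          mul_le_mul_of_nonneg_left h1 (by positivity)
      _ = 2 * π * lam := by rw [hh_def]; field_simp
  have hd2 : 3 * h / t ≤ 3 := by
    rw [div_le_iff₀ ht0]; nlinarith
  rw [abs_div, abs_of_pos hπ, div_le_iff₀ hπ]
  calc |riemannSiegelTheta (t + h) - riemannSiegelTheta t|
      = |(riemannSiegelTheta (t + h) - riemannSiegelTheta t - h / 2 * Real.log (t / (2 * π))) +
          h / 2 * Real.log (t / (2 * π))| := by ring_nf
    _ ≤ 3 * h / t + 2 * π * lam := (abs_add_le _ _).trans (add_le_add hd hm)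
    _ ≤ (2 * lam + 1) * π := by nlinarith

set_option maxHeartbeats 400000 in
/-- **The cross term of GLSS 2026, Proposition 2 (first display) is `o(T)`**: with
`h = λ/L = 2πλ/log T`, for each `λ > 0` and all large `T`,
`|∫_0^T ((θ(t+h) − θ(t))/π)(S(t+h) − S(t)) dt| ≤ T`. Proof (our route; a gloss): shift the first
summand by `h` (`∫_0^T g(t)S(t+h) dt = ∫_h^{T+h} g(u−h)S(u) du`), so that the cross term is
`∫_h^T (g(u−h) − g(u))S(u) du + ∫_T^{T+h} g(u−h)S(u) du − ∫_0^h gS`; the second difference of `θ`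
is `≤ 10h/u` on `u ≥ 2` (`abs_theta_secondDiff_le`), `|g| ≤ 2λ + 1` on `[1, T]` and `≤ 2M/π` near
`0`, and `|S(u)| ≤ C log(T+1) + C₀` on `[0, T+1]` (`S(T) = O(log T)`, tree
`isBigO_zetaArgS_log_holds`); everything is `O_λ(log T)·O(log T)`-free: in fact `O_λ(log T)`,
which is `≤ T` for large `T`. Cauchy–Schwarz would only give `O(λ T √log(2+λ))`, not admissible for
the absolute constant of `glss2026_dsec2`. [cite: GoldstonLeeSchettlerSuriajaya2026, §3 Proposition
2] -/
theorem abs_integral_thetaWindow_mul_argWindow_le {lam : ℝ} (hlam : 0 < lam) :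
    ∀ᶠ T : ℝ in atTop,
      |∫ t in (0 : ℝ)..T, ((riemannSiegelTheta (t + lam / L T) - riemannSiegelTheta t) / π) *
          (zetaArgS (t + lam / L T) - zetaArgS t)| ≤ T := by
  have hπ : 0 < π := Real.pi_pos
  have hπ3 : 3 < π := Real.pi_gt_three
  have hθc : Continuous riemannSiegelTheta := continuous_riemannSiegelTheta
  have hSm : Measurable zetaArgS := SelbergFujii.measurable_zetaArgS
  obtain ⟨M, hM⟩ := (isCompact_Icc (a := (0 : ℝ)) (b := 3)).exists_bound_of_continuousOn
    hθc.continuousOn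
  have hM0 : 0 ≤ M := (norm_nonneg _).trans (hM 0 (by norm_num))
  obtain ⟨C, C₀, hC, hC₀, hSb⟩ := exists_abs_zetaArgS_le_log
  -- constants
  set G : ℝ := 2 * M / π + (2 * lam + 1) with hG_def
  have hG0 : 0 < G := by positivity
  set K : ℝ := 6 * G + 20 * lam with hK_def
  have hK0 : 0 < K := by positivity
  -- eventually: K * ((2C + C₀) log T) ≤ T
  have hev : ∀ᶠ T : ℝ in atTop, K * ((2 * C + C₀) * Real.log T) ≤ T := by
    have h := (Real.isLittleO_log_id_atTop.const_mul_left (K * (2 * C + C₀))).def zero_lt_one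
    filter_upwards [h, eventually_gt_atTop (1 : ℝ)] with T hT hT1
    have hl : 0 ≤ Real.log T := Real.log_nonneg hT1.le
    have e1 : ‖K * (2 * C + C₀) * Real.log T‖ = K * (2 * C + C₀) * Real.log T := by
      rw [Real.norm_eq_abs, abs_of_nonneg (by positivity)]
    have e2 : (1 : ℝ) * ‖id T‖ = T := by
      rw [id, Real.norm_eq_abs, abs_of_pos (by linarith), one_mul]
    nlinarith [hT, e1, e2]
  filter_upwards [eventually_ge_atTop (Real.exp (2 * π * lam)), eventually_ge_atTop (Real.exp 2),
    hev] with T hT1 hT2 hT3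
  have hT0 : 0 < T := lt_of_lt_of_le (Real.exp_pos 2) hT2
  have hlogT : 2 ≤ Real.log T := by
    rw [← Real.log_exp 2]; exact Real.log_le_log (Real.exp_pos 2) hT2
  have hlog0 : 0 < Real.log T := by linarith
  have hT2' : 2 ≤ T := by
    have := Real.add_one_le_exp (2 : ℝ); linarith
  have hlogT' : 2 * π * lam ≤ Real.log T := by
    rw [← Real.log_exp (2 * π * lam)]; exact Real.log_le_log (Real.exp_pos _) hT1
  have hL : L T = Real.log T / (2 * π) := rfl
  have hh : lam / L T = 2 * π * lam / Real.log T := by rw [hL]; field_simp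
  set h : ℝ := 2 * π * lam / Real.log T with hh_def
  have hh0 : 0 < h := by positivity
  have hh1 : h ≤ 1 := by rw [hh_def, div_le_one hlog0]; exact hlogT'
  have hhlog : h * Real.log T = 2 * π * lam := by rw [hh_def]; field_simp
  rw [hh]
  -- the bound B for |S| on [0, T+1]
  set B : ℝ := C * Real.log (T + 1) + C₀ with hB_def
  have hB0 : 0 ≤ B := by
    have := Real.log_nonneg (by linarith : (1 : ℝ) ≤ T + 1); positivity
  have hSB : ∀ t ∈ Set.Icc (0 : ℝ) (T + 1), |zetaArgS t| ≤ B := hSb T (by linarith)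
  have hBlog : B ≤ (2 * C + C₀) * Real.log T := by
    have h1 : Real.log (T + 1) ≤ 2 * Real.log T := by
      rw [← Real.log_rpow hT0, show ((2 : ℝ)) = ((2 : ℕ) : ℝ) by norm_num, Real.rpow_natCast]
      exact Real.log_le_log (by linarith) (by nlinarith)
    have h2 : C₀ ≤ C₀ * Real.log T := by nlinarith
    rw [hB_def]; nlinarith
  -- g and its bound on [0, T]
  set g : ℝ → ℝ := fun t ↦ (riemannSiegelTheta (t + h) - riemannSiegelTheta t) / π with hg_def
  have hgc : Continuous g := by rw [hg_def]; fun_prop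
  have hgB : ∀ t ∈ Set.Icc (0 : ℝ) T, |g t| ≤ G := by
    intro t ht
    rcases le_or_gt t 1 with ht1 | ht1
    · -- near 0: |θ| ≤ M on [0, 3]
      have h1 := hM (t + h) ⟨by linarith [ht.1], by linarith⟩
      have h2 := hM t ⟨ht.1, by linarith⟩
      rw [Real.norm_eq_abs] at h1 h2
      rw [hg_def]; simp only
      rw [abs_div, abs_of_pos hπ]
      have h3 : |riemannSiegelTheta (t + h) - riemannSiegelTheta t| / π ≤ 2 * M / π := by
        refine div_le_div_of_nonneg_right ?_ hπ.le
        exact (abs_sub _ _).trans (by linarith)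
      have : 0 ≤ 2 * lam + 1 := by positivity
      linarith
    · have h1 := abs_thetaWindow_div_pi_le hlam hlogT hh1 ht1.le ht.2
      rw [← hh_def] at h1
      rw [hg_def]; simp only
      have : 0 ≤ 2 * M / π := by positivity
      linarith
  -- measurability / integrability of the products
  have hSmh : Measurable fun t ↦ zetaArgS (t + h) := hSm.comp (measurable_id.add_const h)
  have hgm : Measurable g := hgc.measurable
  have hgmh : Measurable fun u ↦ g (u - h) := hgc.measurable.comp (measurable_id.sub_const h)
  have iGS : ∀ a b : ℝ, 0 ≤ a → a ≤ b → b ≤ T →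
      IntervalIntegrable (fun t ↦ g t * zetaArgS t) volume a b := by
    intro a b ha hab hb
    refine intervalIntegrable_of_abs_le' (C := G * B) hab (hgm.mul hSm) fun t ht ↦ ?_
    rw [abs_mul]
    exact mul_le_mul (hgB t ⟨by linarith [ht.1], by linarith [ht.2]⟩)
      (hSB t ⟨by linarith [ht.1], by linarith [ht.2]⟩) (abs_nonneg _) hG0.le
  have iGSh : IntervalIntegrable (fun t ↦ g t * zetaArgS (t + h)) volume 0 T := by
    refine intervalIntegrable_of_abs_le' (C := G * B) hT0.le (hgm.mul hSmh) fun t ht ↦ ?_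
    rw [abs_mul]
    exact mul_le_mul (hgB t ht) (hSB (t + h) ⟨by linarith [ht.1], by linarith [ht.2]⟩)
      (abs_nonneg _) hG0.le
  have iF : ∀ a b : ℝ, h ≤ a → a ≤ b → b ≤ T + h →
      IntervalIntegrable (fun u ↦ g (u - h) * zetaArgS u) volume a b := by
    intro a b ha hab hb
    refine intervalIntegrable_of_abs_le' (C := G * B) hab (hgmh.mul hSm) fun u hu ↦ ?_
    rw [abs_mul]
    exact mul_le_mul (hgB (u - h) ⟨by linarith [hu.1], by linarith [hu.2]⟩)
      (hSB u ⟨by linarith [hu.1], by linarith [hu.2]⟩) (abs_nonneg _) hG0.le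
  -- rewrite the cross term
  have e0 : (∫ t in (0 : ℝ)..T, g t * (zetaArgS (t + h) - zetaArgS t)) =
      (∫ t in (0 : ℝ)..T, g t * zetaArgS (t + h)) - ∫ t in (0 : ℝ)..T, g t * zetaArgS t := by
    rw [← intervalIntegral.integral_sub iGSh (iGS 0 T le_rfl hT0.le le_rfl)]
    refine intervalIntegral.integral_congr fun t _ ↦ ?_
    ring
  have e1 : (∫ t in (0 : ℝ)..T, g t * zetaArgS (t + h)) =
      ∫ u in h..T + h, g (u - h) * zetaArgS u := by
    have := intervalIntegral.integral_comp_add_right (fun u ↦ g (u - h) * zetaArgS u) h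
      (a := 0) (b := T)
    simp only [add_sub_cancel_right, zero_add] at this
    exact this
  have e2 : (∫ u in h..T + h, g (u - h) * zetaArgS u) =
      (∫ u in h..T, g (u - h) * zetaArgS u) + ∫ u in T..T + h, g (u - h) * zetaArgS u :=
    (intervalIntegral.integral_add_adjacent_intervals (iF h T le_rfl (by linarith) (by linarith))
      (iF T (T + h) (by linarith) (by linarith) le_rfl)).symm
  have e3 : (∫ t in (0 : ℝ)..T, g t * zetaArgS t) =
      (∫ t in (0 : ℝ)..h, g t * zetaArgS t) + ∫ t in h..T, g t * zetaArgS t :=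
    (intervalIntegral.integral_add_adjacent_intervals (iGS 0 h le_rfl hh0.le (by linarith))
      (iGS h T hh0.le (by linarith) le_rfl)).symm
  have e4 : (∫ u in h..T, g (u - h) * zetaArgS u) - (∫ t in h..T, g t * zetaArgS t) =
      ∫ u in h..T, (g (u - h) - g u) * zetaArgS u := by
    rw [← intervalIntegral.integral_sub (iF h T le_rfl (by linarith) (by linarith))
      (iGS h T hh0.le (by linarith) le_rfl)]
    refine intervalIntegral.integral_congr fun u _ ↦ ?_
    ring
  have iD : ∀ a b : ℝ, h ≤ a → a ≤ b → b ≤ T →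
      IntervalIntegrable (fun u ↦ (g (u - h) - g u) * zetaArgS u) volume a b := by
    intro a b ha hab hb
    refine intervalIntegrable_of_abs_le' (C := 2 * G * B) hab ((hgmh.sub hgm).mul hSm)
      fun u hu ↦ ?_
    rw [abs_mul]
    have h1 := hgB (u - h) ⟨by linarith [hu.1], by linarith [hu.2]⟩
    have h2 := hgB u ⟨by linarith [hu.1], by linarith [hu.2]⟩
    exact mul_le_mul ((abs_sub _ _).trans (by linarith))
      (hSB u ⟨by linarith [hu.1], by linarith [hu.2]⟩) (abs_nonneg _) (by positivity)
  have e5 : (∫ u in h..T, (g (u - h) - g u) * zetaArgS u) =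
      (∫ u in h..(2 : ℝ), (g (u - h) - g u) * zetaArgS u) +
        ∫ u in (2 : ℝ)..T, (g (u - h) - g u) * zetaArgS u :=
    (intervalIntegral.integral_add_adjacent_intervals (iD h 2 le_rfl (by linarith) hT2')
      (iD 2 T (by linarith) hT2' le_rfl)).symm
  -- the four bounds
  have bα : |∫ u in T..T + h, g (u - h) * zetaArgS u| ≤ G * B * h := by
    have hb := intervalIntegral.norm_integral_le_of_norm_le_const (a := T) (b := T + h)
      (C := G * B) (f := fun u ↦ g (u - h) * zetaArgS u) fun u hu ↦ by
        rw [Set.uIoc_of_le (by linarith)] at hu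
        rw [Real.norm_eq_abs, abs_mul]
        exact mul_le_mul (hgB (u - h) ⟨by linarith [hu.1], by linarith [hu.2]⟩)
          (hSB u ⟨by linarith [hu.1], by linarith [hu.2]⟩) (abs_nonneg _) hG0.le
    rw [Real.norm_eq_abs, show T + h - T = h by ring, abs_of_pos hh0] at hb
    exact hb
  have bβ : |∫ t in (0 : ℝ)..h, g t * zetaArgS t| ≤ G * B * h := by
    have hb := intervalIntegral.norm_integral_le_of_norm_le_const (a := 0) (b := h)
      (C := G * B) (f := fun t ↦ g t * zetaArgS t) fun t ht ↦ by
        rw [Set.uIoc_of_le hh0.le] at ht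
        rw [Real.norm_eq_abs, abs_mul]
        exact mul_le_mul (hgB t ⟨ht.1.le, by linarith [ht.2]⟩)
          (hSB t ⟨ht.1.le, by linarith [ht.2]⟩) (abs_nonneg _) hG0.le
    rw [Real.norm_eq_abs, sub_zero, abs_of_pos hh0] at hb
    exact hb
  have bγ1 : |∫ u in h..(2 : ℝ), (g (u - h) - g u) * zetaArgS u| ≤ 2 * G * B * 2 := by
    have hb := intervalIntegral.norm_integral_le_of_norm_le_const (a := h) (b := 2)
      (C := 2 * G * B) (f := fun u ↦ (g (u - h) - g u) * zetaArgS u) fun u hu ↦ by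
        rw [Set.uIoc_of_le (by linarith)] at hu
        rw [Real.norm_eq_abs, abs_mul]
        have h1 := hgB (u - h) ⟨by linarith [hu.1], by linarith [hu.2]⟩
        have h2 := hgB u ⟨by linarith [hu.1], by linarith [hu.2]⟩
        exact mul_le_mul ((abs_sub _ _).trans (by linarith))
          (hSB u ⟨by linarith [hu.1], by linarith [hu.2]⟩) (abs_nonneg _) (by positivity)
    rw [Real.norm_eq_abs] at hb
    have : |(2 : ℝ) - h| ≤ 2 := by rw [abs_le]; constructor <;> linarith
    have h0 : 0 ≤ 2 * G * B := by positivity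
    exact hb.trans (mul_le_mul_of_nonneg_left this h0)
  have bγ2 : |∫ u in (2 : ℝ)..T, (g (u - h) - g u) * zetaArgS u| ≤ 20 * lam * B := by
    have hb := intervalIntegral.norm_integral_le_of_norm_le (μ := volume)
      (f := fun u ↦ (g (u - h) - g u) * zetaArgS u) (g := fun u ↦ 10 * h / π * B * (1 / u)) hT2'
      (ae_of_all _ fun u hu ↦ ?_) ?_
    · rw [Real.norm_eq_abs] at hb
      refine hb.trans ?_
      rw [intervalIntegral.integral_const_mul, integral_one_div (by
        rw [Set.uIcc_of_le hT2']; intro h0; linarith [h0.1])]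
      have hl : Real.log (T / 2) ≤ Real.log T := Real.log_le_log (by positivity) (by linarith)
      have hl0 : 0 ≤ Real.log (T / 2) := Real.log_nonneg (by linarith)
      calc 10 * h / π * B * Real.log (T / 2) ≤ 10 * h / π * B * Real.log T :=
            mul_le_mul_of_nonneg_left hl (by positivity)
        _ = 10 / π * (h * Real.log T) * B := by ring
        _ = 10 / π * (2 * π * lam) * B := by rw [hhlog]
        _ = 20 * lam * B := by
            field_simp
            ring
    · have hu2 : 2 ≤ u := hu.1.le
      have hu0 : 0 < u := by linarith
      rw [Real.norm_eq_abs, abs_mul]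
      have hsd := abs_theta_secondDiff_le hu2 hh0.le hh1
      have h1 : |g (u - h) - g u| ≤ 10 * h / π * (1 / u) := by
        rw [hg_def]; simp only
        rw [sub_add_cancel, ← sub_div, abs_div, abs_of_pos hπ, div_le_iff₀ hπ]
        calc |riemannSiegelTheta u - riemannSiegelTheta (u - h) -
              (riemannSiegelTheta (u + h) - riemannSiegelTheta u)|
            = |(riemannSiegelTheta (u + h) - riemannSiegelTheta u) -
                (riemannSiegelTheta u - riemannSiegelTheta (u - h))| := abs_sub_comm _ _
          _ ≤ 10 * h / u := hsd
          _ = 10 * h / π * (1 / u) * π := by field_simp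
      calc |g (u - h) - g u| * |zetaArgS u| ≤ 10 * h / π * (1 / u) * B :=
            mul_le_mul h1 (hSB u ⟨hu0.le, by linarith [hu.2]⟩) (abs_nonneg _) (by positivity)
        _ = 10 * h / π * B * (1 / u) := by ring
    · refine ContinuousOn.intervalIntegrable ?_
      rw [Set.uIcc_of_le hT2']
      refine continuousOn_const.mul (continuousOn_const.div continuousOn_id fun x hx ↦ ?_)
      exact ne_of_gt (show (0 : ℝ) < x by linarith [hx.1])
  -- assemble
  have eX : (∫ t in (0 : ℝ)..T, g t * (zetaArgS (t + h) - zetaArgS t)) =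
      (∫ u in h..(2 : ℝ), (g (u - h) - g u) * zetaArgS u) +
        (∫ u in (2 : ℝ)..T, (g (u - h) - g u) * zetaArgS u) +
        (∫ u in T..T + h, g (u - h) * zetaArgS u) - ∫ t in (0 : ℝ)..h, g t * zetaArgS t := by
    rw [e0, e1, e2, e3, ← e5, ← e4]
    ring
  have hfin : K * B ≤ T := le_trans (mul_le_mul_of_nonneg_left hBlog hK0.le) hT3
  have hgoal : |∫ t in (0 : ℝ)..T, g t * (zetaArgS (t + h) - zetaArgS t)| ≤ T := by
    rw [eX]
    refine le_trans ?_ hfin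
    calc |(∫ u in h..(2 : ℝ), (g (u - h) - g u) * zetaArgS u) +
          (∫ u in (2 : ℝ)..T, (g (u - h) - g u) * zetaArgS u) +
          (∫ u in T..T + h, g (u - h) * zetaArgS u) - ∫ t in (0 : ℝ)..h, g t * zetaArgS t|
        ≤ |∫ u in h..(2 : ℝ), (g (u - h) - g u) * zetaArgS u| +
          |∫ u in (2 : ℝ)..T, (g (u - h) - g u) * zetaArgS u| +
          |∫ u in T..T + h, g (u - h) * zetaArgS u| + |∫ t in (0 : ℝ)..h, g t * zetaArgS t| := by
          refine (abs_sub _ _).trans (add_le_add ((abs_add_le _ _).trans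
            (add_le_add (abs_add_le _ _) le_rfl)) le_rfl)
      _ ≤ 2 * G * B * 2 + 20 * lam * B + G * B * h + G * B * h :=
          add_le_add (add_le_add (add_le_add bγ1 bγ2) bα) bβ
      _ ≤ K * B := by
          have h0 : 0 ≤ G * B := by positivity
          have h1 : G * B * h ≤ G * B := by
            have := mul_le_mul_of_nonneg_left hh1 h0; simpa using this
          have e : K * B = 2 * G * B * 2 + 20 * lam * B + G * B + G * B := by
            rw [hK_def]; ring
          rw [e]
          linarith
  simpa only [hg_def] using hgoal

end GLSS2026

/-- **GLSS 2026, Proposition 2, first display (Gallagher–Mueller / Riemann–von Mangoldt algebra),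
PROVED in the weakened form used by the assembly**: for each `λ > 0` and all large `T`,
`|∫_0^T (N(t+λ/L) − N(t))² dt − λ²T − ∫_0^T (S(t+λ/L) − S(t))² dt| ≤ 6 (λ²T/L + T)`
(printed: "`= λ²T + O(λ²T/L) + ∫_0^T (S(t+λ/L) − S(t))² dt + O(L²)`"; our `O(T)` replaces `O(L²)`,
see `glss2026_dsec2_of_prop2a_of_fujii`). Proof: `N(t+h) − N(t) = (S(t+h) − S(t)) + (θ(t+h) −
θ(t))/π` (`S = N − θ/π − 1`), so the left side is `(∫ g² − λ²T) + 2∫ g·ΔS` with `g = Δθ/π`: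
the `θ`-diagonal `GLSS2026.abs_integral_thetaWindow_sq_sub_le` (`≤ 4(λ²T/L + T)`) and the cross
term `GLSS2026.abs_integral_thetaWindow_mul_argWindow_le` (`≤ T`).
[cite: GoldstonLeeSchettlerSuriajaya2026, §3 Proposition 2] -/
theorem glss2026_proposition2a :
    ∃ A₂ : ℝ, ∀ lam : ℝ, 0 < lam → ∀ᶠ T : ℝ in atTop,
      |(∫ t in (0 : ℝ)..T,
            ((zetaZeroCount (t + lam / GLSS2026.L T) : ℝ) - zetaZeroCount t) ^ 2) -
          lam ^ 2 * T -
          ∫ t in (0 : ℝ)..T, (zetaArgS (t + lam / GLSS2026.L T) - zetaArgS t) ^ 2| ≤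
        A₂ * (lam ^ 2 * T / GLSS2026.L T + T) := by
  obtain ⟨A, hA⟩ := GLSS2026.abs_integral_thetaWindow_sq_sub_le
  -- A ≤ |A|; we use the bound with |A| and take A₂ = |A| + 2
  refine ⟨|A| + 2, fun lam hlam ↦ ?_⟩
  filter_upwards [hA lam hlam, GLSS2026.abs_integral_thetaWindow_mul_argWindow_le hlam,
    eventually_ge_atTop (Real.exp (2 * π * lam)), eventually_gt_atTop (1 : ℝ)]
    with T hθ hX hT1 hT
  have hπ : 0 < π := Real.pi_pos
  have hT0 : 0 < T := by linarith
  have hL : 0 < GLSS2026.L T := GLSS2026.L_pos hT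
  have hLdef : GLSS2026.L T = Real.log T / (2 * π) := rfl
  have hlogT' : 2 * π * lam ≤ Real.log T := by
    rw [← Real.log_exp (2 * π * lam)]; exact Real.log_le_log (Real.exp_pos _) hT1
  set h : ℝ := lam / GLSS2026.L T with hh_def
  have hh0 : 0 ≤ h := by positivity
  have hh1 : h ≤ 1 := by
    rw [hh_def, hLdef, div_le_one (by positivity)]
    rw [le_div_iff₀ (by positivity)]; linarith
  -- the three integrands
  set g : ℝ → ℝ := fun t ↦ (riemannSiegelTheta (t + h) - riemannSiegelTheta t) / π with hg
  set dS : ℝ → ℝ := fun t ↦ zetaArgS (t + h) - zetaArgS t with hdS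
  set dN : ℝ → ℝ := fun t ↦ (zetaZeroCount (t + h) : ℝ) - zetaZeroCount t with hdN
  have hNS : ∀ t, dN t = dS t + g t := by
    intro t
    simp only [hdN, hdS, hg, zetaArgS]
    ring
  -- integrability
  have hθc : Continuous riemannSiegelTheta := continuous_riemannSiegelTheta
  have ig2 : IntervalIntegrable (fun t ↦ g t ^ 2) volume 0 T := by
    apply Continuous.intervalIntegrable
    rw [hg]; fun_prop
  have idS2 : IntervalIntegrable (fun t ↦ dS t ^ 2) volume 0 T := by
    have := SelbergFujii.intervalIntegrable_zetaArgS_sub_pow (T := T / 2) (h := h)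
      (by positivity) hh0 hh1 2
    rw [show 2 * (T / 2) = T by ring] at this
    simpa only [hdS] using this
  have idN2 : IntervalIntegrable (fun t ↦ dN t ^ 2) volume 0 T := by
    have hm1 : Measurable fun t : ℝ ↦ (zetaZeroCount (t + h) : ℝ) := by
      refine Monotone.measurable fun x y hxy ↦ ?_
      exact_mod_cast zetaZeroCount_mono (by linarith : x + h ≤ y + h)
    have hm2 : Measurable fun t : ℝ ↦ (zetaZeroCount t : ℝ) :=
      Monotone.measurable fun x y hxy ↦ by exact_mod_cast zetaZeroCount_mono hxy
    refine GLSS2026.intervalIntegrable_of_abs_le' (C := ((zetaZeroCount (T + h) : ℝ) +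
      zetaZeroCount T) ^ 2) hT0.le ((hm1.sub hm2).pow_const 2) fun t ht ↦ ?_
    rw [abs_pow, sq_abs]
    have h1 : (zetaZeroCount (t + h) : ℝ) ≤ zetaZeroCount (T + h) := by
      exact_mod_cast zetaZeroCount_mono (by linarith [ht.2] : t + h ≤ T + h)
    have h2 : (zetaZeroCount t : ℝ) ≤ zetaZeroCount T := by exact_mod_cast zetaZeroCount_mono ht.2
    have h3 : (0 : ℝ) ≤ zetaZeroCount (t + h) := Nat.cast_nonneg _
    have h4 : (0 : ℝ) ≤ zetaZeroCount t := Nat.cast_nonneg _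
    have h5 : |dN t| ≤ (zetaZeroCount (T + h) : ℝ) + zetaZeroCount T := by
      simp only [hdN]; rw [abs_le]; constructor <;> linarith
    calc dN t ^ 2 = |dN t| ^ 2 := (sq_abs _).symm
      _ ≤ ((zetaZeroCount (T + h) : ℝ) + zetaZeroCount T) ^ 2 :=
          pow_le_pow_left₀ (abs_nonneg _) h5 2
  have igdS : IntervalIntegrable (fun t ↦ g t * dS t) volume 0 T := by
    refine (((idN2.sub idS2).sub ig2).div_const 2).congr fun t _ ↦ ?_
    simp only [hNS]
    ring
  -- the identity ∫ dN² − ∫ dS² = ∫ g² + 2 ∫ g dS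
  have e : (∫ t in (0 : ℝ)..T, dN t ^ 2) - lam ^ 2 * T - ∫ t in (0 : ℝ)..T, dS t ^ 2 =
      ((∫ t in (0 : ℝ)..T, g t ^ 2) - lam ^ 2 * T) + 2 * ∫ t in (0 : ℝ)..T, g t * dS t := by
    have h1 : ∫ t in (0 : ℝ)..T, dN t ^ 2 =
        ∫ t in (0 : ℝ)..T, (dS t ^ 2 + (g t ^ 2 + 2 * (g t * dS t))) := by
      refine intervalIntegral.integral_congr fun t _ ↦ ?_
      simp only [hNS]; ring
    rw [h1, intervalIntegral.integral_add idS2 (ig2.add (igdS.const_mul 2)),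
      intervalIntegral.integral_add ig2 (igdS.const_mul 2), intervalIntegral.integral_const_mul]
    ring
  have hmain : |(∫ t in (0 : ℝ)..T, dN t ^ 2) - lam ^ 2 * T - ∫ t in (0 : ℝ)..T, dS t ^ 2| ≤
      (|A| + 2) * (lam ^ 2 * T / GLSS2026.L T + T) := by
    rw [e]
    have hq : 0 ≤ lam ^ 2 * T / GLSS2026.L T + T := by positivity
    have hθ' : |(∫ t in (0 : ℝ)..T, g t ^ 2) - lam ^ 2 * T| ≤
        |A| * (lam ^ 2 * T / GLSS2026.L T + T) := by
      refine (le_trans ?_ (mul_le_mul_of_nonneg_right (le_abs_self A) hq))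
      simpa only [hg] using hθ
    have hX' : |∫ t in (0 : ℝ)..T, g t * dS t| ≤ T := by simpa only [hg, hdS] using hX
    calc |(∫ t in (0 : ℝ)..T, g t ^ 2) - lam ^ 2 * T + 2 * ∫ t in (0 : ℝ)..T, g t * dS t|
        ≤ |(∫ t in (0 : ℝ)..T, g t ^ 2) - lam ^ 2 * T| + |2 * ∫ t in (0 : ℝ)..T, g t * dS t| :=
          abs_add_le _ _
      _ ≤ |A| * (lam ^ 2 * T / GLSS2026.L T + T) + 2 * T := by
          rw [abs_mul, abs_two]; linarith
      _ ≤ (|A| + 2) * (lam ^ 2 * T / GLSS2026.L T + T) := by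
          have : 0 ≤ lam ^ 2 * T / GLSS2026.L T := by positivity
          nlinarith
  simpa only [hdN, hdS] using hmain

/-- **GLSS 2026, (3.2) = `glss2026_dsec2` from Fujii's mean square (Titchmarsh (9.25.2)) ALONE.**
With Proposition 1 (`glss2026_proposition1`), Proposition 2's first display
(`glss2026_proposition2a`) and its second display from (9.25.2) (`glss2026_proposition2b_of_fujii`)
all PROVED in this module, the named fact `glss2026_dsec2` (rh-crit/ah G-ah-10) holds as soon as
Fujii's asymptotic `∫_0^T |S(t+h) − S(t)|² dt = π⁻² T log(3 + h log T) + O(T √log(3 + h log T))`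
(`0 ≤ h ≤ T/2`) is supplied — in the binder shape of `SelbergFujii.first_moment_of_moments`; the
tree does not vendor (9.25.2) as a fact (its open analytic input is Selberg's mean-value theorem for
`S(t)`, `SelbergFujiiApproxFormula.lean`). [cite: GoldstonLeeSchettlerSuriajaya2026, §3 eq. (3.2)]
-/
theorem glss2026_dsec2_of_fujii
    (h252 : ∃ A : ℝ, ∃ T₀ : ℝ, ∀ T : ℝ, T₀ ≤ T → ∀ h : ℝ, 0 ≤ h → h ≤ T / 2 →
      |(∫ t in (0 : ℝ)..T, (zetaArgS (t + h) - zetaArgS t) ^ 2) -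
          T * Real.log (3 + h * Real.log T) / π ^ 2| ≤
        A * (T * Real.sqrt (Real.log (3 + h * Real.log T)))) :
    glss2026_dsec2 :=
  glss2026_dsec2_of_prop2a_of_fujii glss2026_proposition2a h252

end Literature.NumberTheory.LFunctions

end
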